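import Summits.AnomalousDissipation.AnomalousDissipation.Theorems.SawtoothPulseCascadeK1LocalisedCascadeKHCornerSources
import Summits.AnomalousDissipation.AnomalousDissipation.Theorems.SawtoothPulseCascadeK1LocalisedCascadeKHCornerFrame
import Summits.AnomalousDissipation.AnomalousDissipation.Theorems.SawtoothPulseCascadeK1LocalisedCascadeKHKernelBlochDeriv
import Summits.AnomalousDissipation.AnomalousDissipation.Theorems.SawtoothPulseCascadeK1LocalisedCascadeKHBlochDuality
import Summits.AnomalousDissipation.AnomalousDissipation.Theorems.SawtoothPulseCascadeK1LocalisedCascadeKHDuhamelAnyLine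
import Summits.AnomalousDissipation.AnomalousDissipation.Theorems.SawtoothPulseCascadeK1LocalisedCascadeKHSingleModeCreation
import Summits.AnomalousDissipation.AnomalousDissipation.Theorems.SawtoothPulseCascadeK1LocalisedCascadeKHForcingModes
import Summits.AnomalousDissipation.AnomalousDissipation.Theorems.SawtoothPulseCascadeK1LocalisedCascadeKHSheetPairEnergy
import Summits.AnomalousDissipation.AnomalousDissipation.Theorems.SawtoothPulseCascadeK1LocalisedCascadeKHTransportCoeff

/-!
# K2 lane — `K2CornerLaw.lean` (crux file #5): **THE CORNER LAW** `CoreStripLaw (1/16) C` — B1 OF RECORD (arbiter A28-10″/A28-11) BY NAME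

prover ad-k1loc-p2 g13 (K2 lane), crux workfile on the dir of stmt-AnomalousDissipation-19491; companion of `K2CreationLaws.lean` (§27:
`EntryBoundsW θ 0 M D ⇐ CoreLineLaw C`) and `K2CoreLineLaw.lean` (§7: `CoreLineLaw ⇐ CoreStripLaw a₀ C₁` for any `a₀ > 0`).  Over p4's VERBATIM
definitions (copied below; `Cruxes/…` modules are not importable) this file proves what was left of B1:

  `theorem coreStripLaw_sixteenth : CoreStripLaw (1 / 16) cornerConst`   and   `theorem coreStripLaw_corner : ∃ a₀ > 0, ∃ C ≥ 0, CoreStripLaw a₀ C`.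

MECHANISM (memo §30, made quantitative by an `H¹–H⁻¹` duality instead of mode-by-mode asymptotics; tree files `…KHBlochDuality`, `…KHKernelBloch`,
`…KHKernelBlochDeriv`, `…KHCornerFrame`, `…KHCornerPhase`, `…KHCornerSources`, all p2 g13):
* in the kink-pair frame `u_b = (e^{iπb/2}, e^{−iπb/2})`, `v_b = (e^{iπb/2}, −e^{−iπb/2})` the block `X` is OFF-DIAGONAL: `U(Xf) = x_vu V(f)`,
  `V(Xf) = x_uv U(f)` with `|x_vu| ≤ 3πa/2` (the pole of `Σ₀` cancels against the pole of `e^{iπb}S`) and `|x_uv| = O(1/a)` (`frame_mulVec_U/V`);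
* the column structure of `lineEnergyOut`: `|Z_n| = |Q_U|` on even columns (among them the corner column `n = 0` of weight `1/(a²+b²)`) and `|Q_V|` on odd
  columns, `Q_U = q₀e^{−iπb/2} + q₁e^{iπb/2}`, `Q_V = q₀e^{−iπb/2} − q₁e^{iπb/2}`;
* Duhamel in the frame: `Q_U = Σ_n c_n ∫₀^θ (C(θ−s) U_n(s) + Sn(θ−s) x_vu V_n(s)) ds`, `Q_V = Σ_n c_n ∫₀^θ (C V_n + Sn x_uv U_n)`, roof `|C|, |Sn|/θ ≤ cosh(8σ⋆)`
  (tree `sq_mul_neg_sawC2_le_sawSigmaStar_sq`: `λ₊ ≤ σ⋆²` on every line);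
* the sources: `U_n(s) = 2·(2πia)·∫ F_U e^{2πi(b+n)y}`, `V_n(s) = 2·(2πia)·∫ F_V e^{2πi(b+n)y}` with the ANTISYMMETRIC kernel pair `F_U` POLE-FREE and `F_V`
  carrying the pole once; by Bessel + integration by parts under the Bloch condition (`…KHBlochDuality`) and the kernel bounds,
  `Σ_n (a²+(b+n)²)|F̂_U(n)|² ≤ 2`, `Σ_n (a²+(b+n)²)|F̂_V(n)|² ≤ 1/a²` (`…KHCornerSources`), so by Cauchy–Schwarz `|Q_U| ≤ a·L_U·√E_in`,
  `|Q_V| ≤ L_V·√E_in`, whence `E_out ≤ |Q_U|²(1/(a²+b²) + 4π²/3) + |Q_V|²·4π²/3 ≤ C·E_in` uniformly on `0 < a ≤ 1/16`, `|b| ≤ ½`;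
* `b ∈ (½, 1]` by the `β`-periodicity of the typed objects and a window shift `K ↦ K+1`; negative lines by the conjugation symmetry
  `(a, b) ↦ (−a, −b)` (`sheetAmps_neg_neg_modeProfile_pos`).
Nothing here is a number of record (truth half; `cornerConst` is astronomically lossy); registry S4 v7.1 / caps untouched.
-/

open Set MeasureTheory intervalIntegral

set_option linter.dupNamespace false

namespace Summit.AnomalousDissipation.AnomalousDissipation.Cruxes.K1LocalisedCascade.K2CornerLaw

open Literature.Analysis.FluidPDE.SawtoothCascade
open Summit.AnomalousDissipation.AnomalousDissipation.Theorems.SawtoothPulseCascade.K2PhaseBudget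

noncomputable section

/-! ## Verbatim copies (p4: `K2ConeSketch.lean` v1.4 §0.1–§0.3, §1, §2; via `K2CoreLineLaw.lean`) -/

/-- The periodised Biot–Savart LINE KERNEL (p2's corrected sign). -/
def lineKernel (a β y : ℝ) : ℂ :=
  let κ : ℝ := 2 * Real.pi * |a|
  let r : ℝ := y - (⌊y⌋ : ℝ)
  let z : ℂ := Complex.exp (2 * Real.pi * β * Complex.I)
  Complex.exp (2 * Real.pi * β * (⌊y⌋ : ℝ) * Complex.I) *
    ((-(((Real.exp (-(κ * r)) : ℂ) / (1 - (starRingEnd ℂ z) * (Real.exp (-κ) : ℂ)))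
          + (Real.exp (κ * (r - 1)) : ℂ) * z / (1 - z * (Real.exp (-κ) : ℂ)))) / (2 * κ : ℂ))

/-- Transport multiplier of an H slot of total strain `θ` on the streamwise mode `a`. -/
def transportPhase (a θ y : ℝ) : ℂ :=
  Complex.exp (-(2 * Real.pi * a * θ * triWave y : ℝ) * Complex.I)

/-- The 2 × 2 Kelvin–Helmholtz block of the kink-sheet pair. -/
def blockX (a β : ℝ) : Matrix (Fin 2) (Fin 2) ℂ :=
  ((2 * Real.pi * a : ℝ) * Complex.I : ℂ) •
    !![-(1 / 4 : ℂ) - 2 * lineKernel a β 0, -2 * lineKernel a β (1 / 2);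
       2 * starRingEnd ℂ (lineKernel a β (1 / 2)), (1 / 4 : ℂ) + 2 * lineKernel a β 0]

/-- `λ(a, β) = -a²·c²(a, β)`. -/
def khLam (a β : ℝ) : ℝ := -(a ^ 2 * sawC2 a β)

/-- `C(t)`: `cosh(√λ t)` / `cos(√(-λ) t)` / `1`. -/
def propC (a β t : ℝ) : ℝ :=
  if 0 < khLam a β then Real.cosh (Real.sqrt (khLam a β) * t)
  else if khLam a β < 0 then Real.cos (Real.sqrt (-(khLam a β)) * t) else 1

/-- `Sn(t)`: `sinh(√λ t)/√λ` / `sin(√(-λ) t)/√(-λ)` / `t`. -/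
def propSn (a β t : ℝ) : ℝ :=
  if 0 < khLam a β then Real.sinh (Real.sqrt (khLam a β) * t) / Real.sqrt (khLam a β)
  else if khLam a β < 0 then Real.sin (Real.sqrt (-(khLam a β)) * t) / Real.sqrt (-(khLam a β)) else t

/-- The explicit propagator `P(t) = C(t)·1 + Sn(t)·X`. -/
def propagator (a β t : ℝ) : Matrix (Fin 2) (Fin 2) ℂ :=
  ((propC a β t : ℝ) : ℂ) • (1 : Matrix (Fin 2) (Fin 2) ℂ) + ((propSn a β t : ℝ) : ℂ) • blockX a β

/-- S-4 state of ONE line family. -/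
structure LamState where
  interior : ℝ → ℂ
  sheets : List (ℝ × ℂ)

/-- Forcing of the block at slot-time `s`. -/
def forcing (a β : ℝ) (st : LamState) (s : ℝ) : Fin 2 → ℂ :=
  let src : ℝ → ℂ := fun y0 =>
    (∫ y in (-(1 / 2 : ℝ))..(1 / 2), lineKernel a β (y0 - y) * st.interior y * transportPhase a s y)
      + (st.sheets.map (fun p => lineKernel a β (y0 - p.1) * p.2 * transportPhase a s p.1)).sum
  ![((2 * Real.pi * a : ℝ) * Complex.I : ℂ) * (-2) * src (1 / 4),
    ((2 * Real.pi * a : ℝ) * Complex.I : ℂ) * 2 * src (-(1 / 4))]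

/-- Fresh sheet amplitudes after strain `θ` (Duhamel): `q(θ) = ∫₀^θ P(θ - s) f(s) ds`. -/
def sheetAmps (a β θ : ℝ) (st : LamState) : Fin 2 → ℂ :=
  ∫ s in (0 : ℝ)..θ, (propagator a β (θ - s)).mulVec (forcing a β st s)

/-- The truncation window `[-K, K]`. -/
def win (K : ℕ) : Finset ℤ := Finset.Icc (-(K : ℤ)) K

/-- The transverse profile `y ↦ Σ_{|n| ≤ K} c(n) e^{2πi(β+n)y}` of a truncated coefficient row. -/
def modeProfile (β : ℝ) (K : ℕ) (c : ℤ → ℂ) : ℝ → ℂ :=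
  fun y => ∑ n ∈ win K, c n * Complex.exp ((2 * Real.pi * (β + n) * y : ℝ) * Complex.I)

/-! ## Copies (`K2CoreLineLaw.lean` §1, §4, §8, §9, §17; `K2CreationLaws.lean` §27): kernel glue, single modes, linearity, conjugation symmetry, the roof, the Duhamel formula on any line, line energy -/

/-- The tree's closed form of the kernel on one period. -/
def kernelK (a β : ℝ) : ℝ → ℂ := fun r : ℝ => (-((Real.exp (-(2 * Real.pi * a * r)) : ℂ) /
            (1 - starRingEnd ℂ (Complex.exp (2 * Real.pi * β * Complex.I)) * (Real.exp (-(2 * Real.pi * a)) : ℂ))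
          + (Real.exp (2 * Real.pi * a * (r - 1)) : ℂ) * Complex.exp (2 * Real.pi * β * Complex.I) /
            (1 - Complex.exp (2 * Real.pi * β * Complex.I) * (Real.exp (-(2 * Real.pi * a)) : ℂ))) /
        (2 * (2 * Real.pi * a) : ℂ))

/-- For `a > 0`, `lineKernel a β u = e^{2πiβ⌊u⌋} kernelK a β (u − ⌊u⌋)`. -/
theorem lineKernel_eq {a : ℝ} (ha : 0 < a) (β : ℝ) (u : ℝ) :
    lineKernel a β u = Complex.exp (2 * Real.pi * β * (⌊u⌋ : ℝ) * Complex.I) * kernelK a β (u - ⌊u⌋) := by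
  simp only [lineKernel, kernelK, abs_of_pos ha]
  push_cast
  ring_nf

/-- `2π · lineKernel a β 0 = Σ₀(a,β)` (tree `twoPi_lineKernel_zero`). -/
theorem twoPi_lineKernel_zero' {a : ℝ} (ha : 0 < a) (β : ℝ) :
    (2 * Real.pi : ℂ) * lineKernel a β 0 = ((sawSigma0 a β : ℝ) : ℂ) := by
  have h := twoPi_lineKernel_zero ha β
  have hz : Complex.exp (2 * Real.pi * β * Complex.I) = Complex.exp (((2 * Real.pi * β : ℝ) : ℂ) * Complex.I) := by push_cast; ring_nf
  simp only [lineKernel, Int.floor_zero, Int.cast_zero, Complex.ofReal_zero, sub_zero, mul_zero, zero_mul, neg_zero, Real.exp_zero,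
    Complex.ofReal_one, Complex.exp_zero, one_mul, zero_sub, mul_neg, mul_one, abs_of_pos ha, hz]
  convert h using 3
  push_cast
  ring

/-- `2π · conj (lineKernel a β ½) = S_β(a)` (tree `twoPi_conj_lineKernel_half`). -/
theorem twoPi_conj_lineKernel_half' {a : ℝ} (ha : 0 < a) (β : ℝ) :
    (2 * Real.pi : ℂ) * starRingEnd ℂ (lineKernel a β (1 / 2)) = sawS a β := by
  have h := twoPi_conj_lineKernel_half ha β
  have hz : Complex.exp (2 * Real.pi * β * Complex.I) = Complex.exp (((2 * Real.pi * β : ℝ) : ℂ) * Complex.I) := by push_cast; ring_nf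
  have hfl : ⌊(1 / 2 : ℝ)⌋ = 0 := by norm_num [Int.floor_eq_zero_iff]
  have he1 : Real.exp (-(2 * Real.pi * a * (1 / 2))) = Real.exp (-(a * Real.pi)) := by congr 1; ring
  have he2 : Real.exp (2 * Real.pi * a * (1 / 2 - 1)) = Real.exp (-(a * Real.pi)) := by congr 1; ring
  simp only [lineKernel, hfl, Int.cast_zero, Complex.ofReal_zero, sub_zero, mul_zero, zero_mul, Complex.exp_zero, one_mul,
    abs_of_pos ha, hz, he1, he2]
  convert h using 3
  push_cast
  ring

/-- The block entries spelled out. -/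
theorem blockX_apply (a β : ℝ) :
    blockX a β 0 0 = (((2 * Real.pi * a : ℝ) : ℂ) * Complex.I) * (-(1 / 4 : ℂ) - 2 * lineKernel a β 0) ∧
    blockX a β 0 1 = (((2 * Real.pi * a : ℝ) : ℂ) * Complex.I) * (-2 * lineKernel a β (1 / 2)) ∧
    blockX a β 1 0 = (((2 * Real.pi * a : ℝ) : ℂ) * Complex.I) * (2 * starRingEnd ℂ (lineKernel a β (1 / 2))) ∧
    blockX a β 1 1 = (((2 * Real.pi * a : ℝ) : ℂ) * Complex.I) * ((1 / 4 : ℂ) + 2 * lineKernel a β 0) := by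
  simp [blockX, Matrix.smul_apply, smul_eq_mul]

/-- The kernel is even in `a`. -/
theorem lineKernel_neg (a β y : ℝ) : lineKernel (-a) β y = lineKernel a β y := by
  simp only [lineKernel, abs_neg]

/-- The transport phase at `−a` is the conjugate. -/
theorem transportPhase_neg (a θ y : ℝ) : transportPhase (-a) θ y = starRingEnd ℂ (transportPhase a θ y) := by
  simp only [transportPhase, ← Complex.exp_conj, map_mul, map_neg, Complex.conj_ofReal, Complex.conj_I]
  congr 1
  push_cast
  ring

/-- The single interior mode `e^{2πiξy}` (no sheets) — p2 g10's `K2StableCreation.singleMode`, verbatim. -/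
def singleMode (ξ : ℝ) : LamState := ⟨fun y => Complex.exp (((2 * Real.pi * ξ * y : ℝ) : ℂ) * Complex.I), []⟩

/-- The single-mode source at the kink line `y₀` as a function of the strain time (any Bloch phase). -/
def src (a β ξ y₀ : ℝ) : ℝ → ℂ := fun s =>
  ∫ y in (-(1 / 2 : ℝ))..(1 / 2 : ℝ), lineKernel a β (y₀ - y) * Complex.exp (((2 * Real.pi * ξ * y : ℝ) : ℂ) * Complex.I) *
    Complex.exp (-((2 * Real.pi * a * s * triWave y : ℝ) : ℂ) * Complex.I)

/-- The forcing of the single mode: `f(s) = (2πia·(−2)·src(¼,s), 2πia·2·src(−¼,s))`. -/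
theorem forcing_singleMode (a β ξ s : ℝ) :
    forcing a β (singleMode ξ) s = ![((2 * Real.pi * a : ℝ) * Complex.I : ℂ) * (-2) * src a β ξ (1 / 4) s,
      ((2 * Real.pi * a : ℝ) * Complex.I : ℂ) * 2 * src a β ξ (-(1 / 4)) s] := by
  simp only [forcing, singleMode, transportPhase, src, List.map_nil, List.sum_nil, add_zero]

/-- The single-mode sources are continuous in the strain time. -/
theorem continuous_src {a : ℝ} (ha : 0 < a) (β ξ : ℝ) {y₀ : ℝ} (hy₀ : y₀ = 1 / 4 ∨ y₀ = -(1 / 4)) : Continuous (src a β ξ y₀) :=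
  continuous_singleMode_src ha β ξ (K := kernelK a β) rfl (lineKernel_eq ha β) hy₀

/-- The forcing is linear in the interior content (tree `integral_forcing_finset_sum`). -/
theorem forcing_modeProfile {a : ℝ} (ha : 0 < a) (β s : ℝ) (K : ℕ) (c : ℤ → ℂ) :
    forcing a β ⟨modeProfile β K c, []⟩ s = ∑ n ∈ win K, c n • forcing a β (singleMode (β + n)) s := by
  have h1 := integral_forcing_finset_sum ha β s (K := kernelK a β) rfl (lineKernel_eq ha β) (y₀ := 1 / 4) (Or.inl rfl) (win K) c
  have h2 := integral_forcing_finset_sum ha β s (K := kernelK a β) rfl (lineKernel_eq ha β) (y₀ := -(1 / 4)) (Or.inr rfl) (win K) c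
  ext i
  rw [Finset.sum_apply]
  fin_cases i
  · simp only [forcing, modeProfile, singleMode, transportPhase, List.map_nil, List.sum_nil, add_zero, Fin.zero_eta, Fin.isValue,
      Matrix.cons_val_zero, Pi.smul_apply, smul_eq_mul]
    rw [h1, Finset.mul_sum]
    exact Finset.sum_congr rfl fun n _ => by ring
  · simp only [forcing, modeProfile, singleMode, transportPhase, List.map_nil, List.sum_nil, add_zero, Fin.mk_one, Fin.isValue,
      Matrix.cons_val_one, Matrix.cons_val_zero, Pi.smul_apply, smul_eq_mul]
    rw [h2, Finset.mul_sum]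
    exact Finset.sum_congr rfl fun n _ => by ring

/-- `c²` is even in the Bloch phase (tree `sawSigma0_neg_bloch`, `sawS_neg_bloch`). -/
theorem sawC2_neg_bloch (a β : ℝ) : sawC2 a (-β) = sawC2 a β := by
  unfold sawC2
  rw [sawSigma0_neg_bloch, sawS_neg_bloch, Complex.normSq_conj]

/-- `conj (lineKernel a β y) = lineKernel a (−β) y`. -/
theorem conj_lineKernel (a β y : ℝ) : starRingEnd ℂ (lineKernel a β y) = lineKernel a (-β) y := by
  have hz : starRingEnd ℂ (Complex.exp (2 * Real.pi * β * Complex.I)) = Complex.exp (2 * Real.pi * (((-β : ℝ)) : ℂ) * Complex.I) := by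
    rw [← Complex.exp_conj]; congr 1
    simp only [map_mul, map_ofNat, Complex.conj_ofReal, Complex.conj_I]; push_cast; ring
  have hz' : starRingEnd ℂ (Complex.exp (2 * Real.pi * β * (⌊y⌋ : ℝ) * Complex.I)) = Complex.exp (2 * Real.pi * (((-β : ℝ)) : ℂ) * (⌊y⌋ : ℝ) * Complex.I) := by
    rw [← Complex.exp_conj]; congr 1
    simp only [map_mul, map_ofNat, Complex.conj_ofReal, Complex.conj_I]; push_cast; ring
  simp only [lineKernel, map_mul, map_div₀, map_add, map_neg, map_sub, map_one, map_ofNat, Complex.conj_ofReal, hz, hz']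

/-- `sawQ (−k) = (sawQ k)⁻¹`. -/
theorem sawQ_neg (k : ℝ) : sawQ (-k) = (sawQ k)⁻¹ := by
  simp only [sawQ, mul_neg, neg_neg, ← Real.exp_neg]

/-- `Σ₀` is even in the streamwise wavenumber (`k ≠ 0`). -/
theorem sawSigma0_neg_arg {k : ℝ} (hk : k ≠ 0) (β : ℝ) : sawSigma0 (-k) β = sawSigma0 k β := by
  have hq : 0 < sawQ k := Real.exp_pos _
  have hq1 : sawQ k ≠ 1 := by
    simp only [sawQ]; rw [Ne, Real.exp_eq_one_iff]; intro h; apply hk; nlinarith [Real.pi_pos]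
  have hc : Real.cos (2 * Real.pi * β) ≤ 1 := Real.cos_le_one _
  have hc' : -1 ≤ Real.cos (2 * Real.pi * β) := Real.neg_one_le_cos _
  have hden : 1 - 2 * sawQ k * Real.cos (2 * Real.pi * β) + sawQ k ^ 2 ≠ 0 := by
    intro h
    have h1 : (1 - sawQ k) ^ 2 ≤ 1 - 2 * sawQ k * Real.cos (2 * Real.pi * β) + sawQ k ^ 2 := by nlinarith
    have h2 : (1 - sawQ k) ^ 2 = 0 := le_antisymm (by rw [← h]; exact h1) (sq_nonneg _)
    exact hq1 (by nlinarith [pow_eq_zero_iff (n := 2) (two_ne_zero) |>.1 h2])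
  unfold sawSigma0
  rw [sawQ_neg]
  field_simp
  ring

/-- `S` is even in the streamwise wavenumber (`k ≠ 0`). -/
theorem sawS_neg_arg {k : ℝ} (hk : k ≠ 0) (β : ℝ) : sawS (-k) β = sawS k β := by
  have hq : 0 < sawQ k := Real.exp_pos _
  have hq1 : sawQ k ≠ 1 := by
    simp only [sawQ]; rw [Ne, Real.exp_eq_one_iff]; intro h; apply hk; nlinarith [Real.pi_pos]
  set z : ℂ := Complex.exp (((2 * Real.pi * β : ℝ) : ℂ) * Complex.I) with hz
  set Q : ℂ := ((sawQ k : ℝ) : ℂ) with hQ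
  have hzn : ‖z‖ = 1 := by rw [hz, Complex.norm_exp_ofReal_mul_I]
  have hz0 : z ≠ 0 := by intro h; rw [h, norm_zero] at hzn; exact zero_ne_one hzn
  have hzz : z * starRingEnd ℂ z = 1 := by
    rw [Complex.mul_conj, Complex.normSq_eq_norm_sq, hzn]; norm_num
  have hzbar : starRingEnd ℂ z = z⁻¹ := by
    have := congrArg (fun w => z⁻¹ * w) hzz
    simp only [← mul_assoc, inv_mul_cancel₀ hz0, one_mul, mul_one] at this
    exact this
  have hQ0 : Q ≠ 0 := by rw [hQ]; exact_mod_cast hq.ne'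
  have hQn : ‖Q‖ = sawQ k := by rw [hQ, Complex.norm_real, Real.norm_eq_abs, abs_of_pos hq]
  -- the two non-resonance facts `z ≠ Q`, `zQ ≠ 1`
  have F2 : Q - z ≠ 0 := by
    intro h
    have : ‖Q‖ = ‖z‖ := by rw [sub_eq_zero.1 h]
    rw [hQn, hzn] at this
    exact hq1 this
  have F1 : 1 - z * Q ≠ 0 := by
    intro h
    have : ‖z * Q‖ = 1 := by rw [← sub_eq_zero.1 h]; exact norm_one
    rw [norm_mul, hzn, hQn, one_mul] at this
    exact hq1 this
  have F3 : Q - z⁻¹ ≠ 0 := by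
    intro h
    have h' : z * Q = 1 := by
      have := congrArg (fun w => z * w) (sub_eq_zero.1 h)
      simpa [mul_inv_cancel₀ hz0] using this
    exact F1 (by rw [h']; ring)
  have F4 : z - Q ≠ 0 := by intro h; exact F2 (by rw [← neg_sub, h, neg_zero])
  have F1' : 1 - Q * z ≠ 0 := by rwa [mul_comm] at F1
  have F1'' : -1 + Q * z ≠ 0 := by
    intro h; apply F1'; linear_combination -h
  have F5 : Q * z - 1 ≠ 0 := by
    intro h; apply F1'; linear_combination -h
  have hk' : (k : ℂ) ≠ 0 := by exact_mod_cast hk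
  -- rewrite everything in terms of `z`, `z⁻¹`, `Q`, `Q⁻¹`
  have hexp : ((Real.exp (-(-k * Real.pi)) / (2 * -k) : ℝ) : ℂ) = -(((Real.exp (-(k * Real.pi)) / (2 * k) : ℝ) : ℂ) * Q⁻¹ * Q⁻¹ * Q) := by
    have e1 : Real.exp (-(-k * Real.pi)) = Real.exp (-(k * Real.pi)) * ((sawQ k)⁻¹) := by
      rw [sawQ, ← Real.exp_neg, ← Real.exp_add]; congr 1; ring
    rw [e1, hQ]; push_cast; field_simp
  simp only [sawS, sawQ_neg]
  rw [← hz, hzbar, hexp]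
  push_cast
  rw [← hQ]
  field_simp
  ring


/-- `c²` is even in the streamwise wavenumber (`a ≠ 0`). -/
theorem sawC2_neg_arg {a : ℝ} (ha : a ≠ 0) (β : ℝ) : sawC2 (-a) β = sawC2 a β := by
  unfold sawC2
  rw [sawSigma0_neg_arg ha, sawS_neg_arg ha]

/-- `λ(−a, −β) = λ(a, β)` (`a ≠ 0`). -/
theorem khLam_neg_neg {a : ℝ} (ha : a ≠ 0) (β : ℝ) : khLam (-a) (-β) = khLam a β := by
  unfold khLam
  rw [sawC2_neg_bloch, sawC2_neg_arg ha, neg_sq]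

/-- The propagator scalars at `(−a, −β)`. -/
theorem propC_neg_neg {a : ℝ} (ha : a ≠ 0) (β t : ℝ) : propC (-a) (-β) t = propC a β t := by
  simp only [propC, khLam_neg_neg ha]

/-- The propagator scalars at `(−a, −β)`. -/
theorem propSn_neg_neg {a : ℝ} (ha : a ≠ 0) (β t : ℝ) : propSn (-a) (-β) t = propSn a β t := by
  simp only [propSn, khLam_neg_neg ha]

/-- The block at `(−a, −β)` is the entrywise conjugate of the block at `(a, β)`. -/
theorem blockX_neg_neg (a β : ℝ) (i j : Fin 2) : blockX (-a) (-β) i j = starRingEnd ℂ (blockX a β i j) := by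
  obtain ⟨e00, e01, e10, e11⟩ := blockX_apply (-a) (-β)
  obtain ⟨f00, f01, f10, f11⟩ := blockX_apply a β
  have hG : lineKernel a (-β) 0 = starRingEnd ℂ (lineKernel a β 0) := (conj_lineKernel a β 0).symm
  have hH : lineKernel a (-β) (1 / 2) = starRingEnd ℂ (lineKernel a β (1 / 2)) := (conj_lineKernel a β (1 / 2)).symm
  fin_cases i <;> fin_cases j
  · simp only [Fin.zero_eta, Fin.isValue, e00, f00, lineKernel_neg, hG, map_mul, map_sub, map_neg, map_div₀, map_one, map_ofNat,
      Complex.conj_ofReal, Complex.conj_I]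
    push_cast; ring
  · simp only [Fin.zero_eta, Fin.mk_one, Fin.isValue, e01, f01, lineKernel_neg, hH, map_mul, map_neg, map_ofNat, Complex.conj_ofReal,
      Complex.conj_I]
    push_cast; ring
  · simp only [Fin.zero_eta, Fin.mk_one, Fin.isValue, e10, f10, lineKernel_neg, hH, map_mul, map_ofNat, Complex.conj_ofReal, Complex.conj_I,
      Complex.conj_conj]
    push_cast; ring
  · simp only [Fin.mk_one, Fin.isValue, e11, f11, lineKernel_neg, hG, map_mul, map_add, map_div₀, map_one, map_ofNat, Complex.conj_ofReal,
      Complex.conj_I]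
    push_cast; ring

/-- The propagator at `(−a, −β)` is the entrywise conjugate (`a ≠ 0`). -/
theorem propagator_neg_neg {a : ℝ} (ha : a ≠ 0) (β t : ℝ) (i j : Fin 2) :
    propagator (-a) (-β) t i j = starRingEnd ℂ (propagator a β t i j) := by
  simp only [propagator, Matrix.add_apply, Matrix.smul_apply, smul_eq_mul, propC_neg_neg ha, propSn_neg_neg ha, map_add, map_mul,
    Complex.conj_ofReal, blockX_neg_neg]
  congr 2
  fin_cases i <;> fin_cases j <;> simp

/-- The transport phase at `−a` is the conjugate (any strain time). -/
theorem transportPhase_neg' (a s y : ℝ) : transportPhase (-a) s y = starRingEnd ℂ (transportPhase a s y) := transportPhase_neg a s y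

/-- **The forcing of a CONJUGATED interior at `(−a, −β)` is the conjugate of the forcing** (no sheets). -/
theorem forcing_neg_neg_nosheet (a β : ℝ) (g : ℝ → ℂ) (s : ℝ) (j : Fin 2) :
    forcing (-a) (-β) ⟨fun y => starRingEnd ℂ (g y), []⟩ s j = starRingEnd ℂ (forcing a β ⟨g, []⟩ s j) := by
  have hsrc : ∀ y₀ : ℝ, (∫ y in (-(1 / 2 : ℝ))..(1 / 2), lineKernel (-a) (-β) (y₀ - y) * starRingEnd ℂ (g y) * transportPhase (-a) s y) =
      starRingEnd ℂ (∫ y in (-(1 / 2 : ℝ))..(1 / 2), lineKernel a β (y₀ - y) * g y * transportPhase a s y) := by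
    intro y₀
    rw [← intervalIntegral.intervalIntegral_conj]
    refine intervalIntegral.integral_congr fun y _ => ?_
    simp only [map_mul, conj_lineKernel, lineKernel_neg, transportPhase_neg']
  fin_cases j
  · simp only [forcing, List.map_nil, List.sum_nil, add_zero, Fin.zero_eta, Fin.isValue, Matrix.cons_val_zero, hsrc, map_mul, map_neg,
      map_ofNat, Complex.conj_ofReal, Complex.conj_I]
    push_cast; ring
  · simp only [forcing, List.map_nil, List.sum_nil, add_zero, Fin.mk_one, Fin.isValue, Matrix.cons_val_one, Matrix.cons_val_zero, hsrc, map_mul,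
      map_ofNat, Complex.conj_ofReal, Complex.conj_I]
    push_cast; ring

/-- The Duhamel integrand at `(−a, −β)` with conjugated interior is the componentwise conjugate (`a ≠ 0`). -/
theorem duhamelIntegrand_neg_neg_nosheet {a : ℝ} (ha : a ≠ 0) (β θ s : ℝ) (g : ℝ → ℂ) :
    (propagator (-a) (-β) (θ - s)).mulVec (forcing (-a) (-β) ⟨fun y => starRingEnd ℂ (g y), []⟩ s) =
      star ((propagator a β (θ - s)).mulVec (forcing a β ⟨g, []⟩ s)) := by
  funext i
  simp only [Matrix.mulVec, dotProduct, Fin.sum_univ_two, Pi.star_apply, propagator_neg_neg ha, forcing_neg_neg_nosheet, star_add, star_mul',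
    Complex.star_def]

/-- The conjugate of a mode profile is the mode profile of the reflected class with reflected, conjugated coefficients. -/
theorem conj_modeProfile (β : ℝ) (K : ℕ) (c : ℤ → ℂ) (y : ℝ) :
    starRingEnd ℂ (modeProfile β K c y) = modeProfile (-β) K (fun n => starRingEnd ℂ (c (-n))) y := by
  simp only [modeProfile, map_sum, map_mul]
  refine Finset.sum_nbij' (fun n => -n) (fun n => -n) (fun n hn => by simp only [win, Finset.mem_Icc] at hn ⊢; omega) (fun n hn => by simp only [win, Finset.mem_Icc] at hn ⊢; omega)
    (fun n _ => neg_neg n) (fun n _ => neg_neg n) (fun n _ => ?_)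
  rw [neg_neg, ← Complex.exp_conj, map_mul, Complex.conj_ofReal, Complex.conj_I]
  congr 1
  push_cast
  ring

/-- `propC` is continuous in time (each branch is). -/
theorem continuous_propC (a β : ℝ) : Continuous (propC a β) := by
  unfold propC
  split_ifs <;> fun_prop

/-- `propSn` is continuous in time. -/
theorem continuous_propSn (a β : ℝ) : Continuous (propSn a β) := by
  unfold propSn
  split_ifs <;> fun_prop

/-- `|C(t)| ≤ cosh(θ√λ₊)` for `0 ≤ t ≤ θ` — stable, neutral or unstable. -/
theorem abs_propC_le (a β : ℝ) {t θ : ℝ} (ht : 0 ≤ t) (htθ : t ≤ θ) :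
    |propC a β t| ≤ Real.cosh (Real.sqrt (max 0 (khLam a β)) * θ) := by
  unfold propC
  split_ifs with h1 h2
  · rw [max_eq_right h1.le, abs_of_nonneg (Real.cosh_pos _).le]
    exact cosh_mul_le_cosh_mul (Real.sqrt_nonneg _) ht htθ
  · exact abs_cos_le_cosh _ _
  · rw [abs_one]; exact Real.one_le_cosh _

/-- `|Sn(t)| ≤ θ·cosh(θ√λ₊)` for `0 ≤ t ≤ θ` — `sinh y ≤ y cosh y`, `|sin(ωt)| ≤ ωt`, `t ≤ θ`. -/
theorem abs_propSn_le (a β : ℝ) {t θ : ℝ} (ht : 0 ≤ t) (htθ : t ≤ θ) :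
    |propSn a β t| ≤ θ * Real.cosh (Real.sqrt (max 0 (khLam a β)) * θ) := by
  have hθ : 0 ≤ θ := ht.trans htθ
  have hc1 : 1 ≤ Real.cosh (Real.sqrt (max 0 (khLam a β)) * θ) := Real.one_le_cosh _
  unfold propSn
  split_ifs with h1 h2
  · rw [max_eq_right h1.le]
    have hω : 0 < Real.sqrt (khLam a β) := Real.sqrt_pos.2 h1
    calc |Real.sinh (Real.sqrt (khLam a β) * t) / Real.sqrt (khLam a β)| ≤ t * Real.cosh (Real.sqrt (khLam a β) * t) :=
          sinh_div_le_mul_cosh hω ht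
      _ ≤ θ * Real.cosh (Real.sqrt (khLam a β) * θ) :=
          mul_le_mul htθ (cosh_mul_le_cosh_mul hω.le ht htθ) (Real.cosh_pos _).le hθ
  · have hω : Real.sqrt (-(khLam a β)) ≠ 0 := (Real.sqrt_pos.2 (by linarith)).ne'
    calc |Real.sin (Real.sqrt (-(khLam a β)) * t) / Real.sqrt (-(khLam a β))| ≤ t := abs_sin_div_le hω ht
      _ ≤ θ * 1 := by linarith
      _ ≤ θ * Real.cosh (Real.sqrt (max 0 (khLam a β)) * θ) := mul_le_mul_of_nonneg_left hc1 hθ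
  · rw [abs_of_nonneg ht]
    calc t ≤ θ * 1 := by linarith
      _ ≤ θ * Real.cosh (Real.sqrt (max 0 (khLam a β)) * θ) := mul_le_mul_of_nonneg_left hc1 hθ

/-- The Duhamel integrand of the single mode is continuous in the strain time on every line `a > 0`. -/
theorem continuous_duhamelIntegrand_singleMode_pos {a : ℝ} (ha : 0 < a) (β ξ θ : ℝ) :
    Continuous fun s : ℝ => (propagator a β (θ - s)).mulVec (forcing a β (singleMode ξ) s) := by
  have hs0 := continuous_src ha β ξ (y₀ := 1 / 4) (Or.inl rfl)
  have hs1 := continuous_src ha β ξ (y₀ := -(1 / 4)) (Or.inr rfl)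
  have hC : Continuous fun s : ℝ => ((propC a β (θ - s) : ℝ) : ℂ) :=
    Complex.continuous_ofReal.comp ((continuous_propC a β).comp (continuous_const.sub continuous_id))
  have hS : Continuous fun s : ℝ => ((propSn a β (θ - s) : ℝ) : ℂ) :=
    Complex.continuous_ofReal.comp ((continuous_propSn a β).comp (continuous_const.sub continuous_id))
  apply continuous_pi
  intro j
  simp only [forcing_singleMode, propagator, Matrix.add_mulVec, Matrix.smul_mulVec, Matrix.one_mulVec]
  simp only [Pi.add_apply, Pi.smul_apply, smul_eq_mul, Matrix.mulVec, dotProduct, Fin.sum_univ_two]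
  fin_cases j
  · simp only [Fin.zero_eta, Fin.isValue, Matrix.cons_val_zero, Matrix.cons_val_one]
    exact (hC.mul (continuous_const.mul hs0)).add (hS.mul ((continuous_const.mul (continuous_const.mul hs0)).add (continuous_const.mul (continuous_const.mul hs1))))
  · simp only [Fin.mk_one, Fin.isValue, Matrix.cons_val_zero, Matrix.cons_val_one]
    exact (hC.mul (continuous_const.mul hs1)).add (hS.mul ((continuous_const.mul (continuous_const.mul hs0)).add (continuous_const.mul (continuous_const.mul hs1))))

/-- **Reduction, component `0`, any line `a > 0`.** -/
theorem sheetAmps_singleMode_apply_0_pos {a : ℝ} (ha : 0 < a) (β ξ θ : ℝ) :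
    sheetAmps a β θ (singleMode ξ) 0 = ∫ s in (0 : ℝ)..θ,
      ((propC a β (θ - s) : ℝ) : ℂ) * ((((2 * Real.pi * a : ℝ) * Complex.I : ℂ) * (-2)) * src a β ξ (1 / 4) s) +
        ((propSn a β (θ - s) : ℝ) : ℂ) *
          (blockX a β 0 0 * ((((2 * Real.pi * a : ℝ) * Complex.I : ℂ) * (-2)) * src a β ξ (1 / 4) s) +
            blockX a β 0 1 * ((((2 * Real.pi * a : ℝ) * Complex.I : ℂ) * 2) * src a β ξ (-(1 / 4)) s)) := by
  have hint := (continuous_duhamelIntegrand_singleMode_pos ha β ξ θ).intervalIntegrable (μ := volume) 0 θ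
  have hcomp := ((ContinuousLinearMap.proj (R := ℂ) (φ := fun _ : Fin 2 => ℂ) (0 : Fin 2)).intervalIntegral_comp_comm hint).symm
  simp only [ContinuousLinearMap.proj_apply] at hcomp
  unfold sheetAmps
  rw [hcomp]
  refine intervalIntegral.integral_congr fun s _ => ?_
  simp only [forcing_singleMode, propagator, Matrix.add_mulVec, Matrix.smul_mulVec, Matrix.one_mulVec]
  simp only [Pi.add_apply, Pi.smul_apply, smul_eq_mul, Matrix.mulVec, dotProduct, Fin.sum_univ_two, Fin.isValue, Matrix.cons_val_zero,
    Matrix.cons_val_one]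

/-- **Reduction, component `1`, any line `a > 0`.** -/
theorem sheetAmps_singleMode_apply_1_pos {a : ℝ} (ha : 0 < a) (β ξ θ : ℝ) :
    sheetAmps a β θ (singleMode ξ) 1 = ∫ s in (0 : ℝ)..θ,
      ((propC a β (θ - s) : ℝ) : ℂ) * ((((2 * Real.pi * a : ℝ) * Complex.I : ℂ) * 2) * src a β ξ (-(1 / 4)) s) +
        ((propSn a β (θ - s) : ℝ) : ℂ) *
          (blockX a β 1 0 * ((((2 * Real.pi * a : ℝ) * Complex.I : ℂ) * (-2)) * src a β ξ (1 / 4) s) +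
            blockX a β 1 1 * ((((2 * Real.pi * a : ℝ) * Complex.I : ℂ) * 2) * src a β ξ (-(1 / 4)) s)) := by
  have hint := (continuous_duhamelIntegrand_singleMode_pos ha β ξ θ).intervalIntegrable (μ := volume) 0 θ
  have hcomp := ((ContinuousLinearMap.proj (R := ℂ) (φ := fun _ : Fin 2 => ℂ) (1 : Fin 2)).intervalIntegral_comp_comm hint).symm
  simp only [ContinuousLinearMap.proj_apply] at hcomp
  unfold sheetAmps
  rw [hcomp]
  refine intervalIntegral.integral_congr fun s _ => ?_
  simp only [forcing_singleMode, propagator, Matrix.add_mulVec, Matrix.smul_mulVec, Matrix.one_mulVec]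
  simp only [Pi.add_apply, Pi.smul_apply, smul_eq_mul, Matrix.mulVec, dotProduct, Fin.sum_univ_two, Fin.isValue, Matrix.cons_val_zero,
    Matrix.cons_val_one]

/-- Linearity of creation in the profile on every line `a > 0`. -/
theorem sheetAmps_modeProfile_pos {a : ℝ} (ha : 0 < a) (β θ : ℝ) (K : ℕ) (c : ℤ → ℂ) :
    sheetAmps a β θ ⟨modeProfile β K c, []⟩ = ∑ n ∈ win K, c n • sheetAmps a β θ (singleMode (β + n)) := by
  unfold sheetAmps
  simp_rw [forcing_modeProfile ha, Matrix.mulVec_sum, Matrix.mulVec_smul]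
  have hint : ∀ n ∈ win K, IntervalIntegrable (fun s => c n • (propagator a β (θ - s)).mulVec (forcing a β (singleMode (β + n)) s))
      volume 0 θ := fun n _ => ((continuous_duhamelIntegrand_singleMode_pos ha β (β + n) θ).intervalIntegrable (μ := volume) _ _).smul (c n)
  rw [intervalIntegral.integral_finsetSum hint]
  refine Finset.sum_congr rfl fun n _ => ?_
  exact intervalIntegral.integral_smul _ _

/-- The conjugation symmetry `(a, β) ↦ (−a, −β)` of the created amplitudes on every line `a > 0`. -/
theorem sheetAmps_neg_neg_modeProfile_pos {a : ℝ} (ha : 0 < a) (β θ : ℝ) (K : ℕ) (c : ℤ → ℂ) (i : Fin 2) :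
    sheetAmps (-a) (-β) θ ⟨modeProfile (-β) K (fun n => starRingEnd ℂ (c (-n))), []⟩ i =
      starRingEnd ℂ (sheetAmps a β θ ⟨modeProfile β K c, []⟩ i) := by
  have ha0 : a ≠ 0 := ha.ne'
  have hF : Continuous fun s : ℝ => (propagator a β (θ - s)).mulVec (forcing a β ⟨modeProfile β K c, []⟩ s) := by
    have e : (fun s : ℝ => (propagator a β (θ - s)).mulVec (forcing a β ⟨modeProfile β K c, []⟩ s)) =
        fun s : ℝ => ∑ n ∈ win K, c n • (propagator a β (θ - s)).mulVec (forcing a β (singleMode (β + n)) s) := by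
      funext s
      rw [forcing_modeProfile ha β s K c, Matrix.mulVec_sum]
      refine Finset.sum_congr rfl fun n _ => ?_
      rw [Matrix.mulVec_smul]
    rw [e]
    exact continuous_finsetSum _ fun n _ => (continuous_duhamelIntegrand_singleMode_pos ha β (β + n) θ).const_smul (c n)
  have hint_eq : (⟨modeProfile (-β) K (fun n => starRingEnd ℂ (c (-n))), []⟩ : LamState) = ⟨fun y => starRingEnd ℂ (modeProfile β K c y), []⟩ := by
    congr 1
    funext y
    rw [conj_modeProfile]
  rw [hint_eq]
  have e : (fun s : ℝ => (propagator (-a) (-β) (θ - s)).mulVec (forcing (-a) (-β) ⟨fun y => starRingEnd ℂ (modeProfile β K c y), []⟩ s)) =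
      fun s : ℝ => star ((propagator a β (θ - s)).mulVec (forcing a β ⟨modeProfile β K c, []⟩ s)) :=
    funext fun s => duhamelIntegrand_neg_neg_nosheet ha0 β θ s (modeProfile β K c)
  have hF' : Continuous fun s : ℝ => (propagator (-a) (-β) (θ - s)).mulVec (forcing (-a) (-β) ⟨fun y => starRingEnd ℂ (modeProfile β K c y), []⟩ s) := by
    rw [e]; exact continuous_star.comp hF
  have hint := hF.intervalIntegrable (μ := volume) 0 θ
  have hint' := hF'.intervalIntegrable (μ := volume) 0 θ
  have h1 := ((ContinuousLinearMap.proj (R := ℂ) (φ := fun _ : Fin 2 => ℂ) i).intervalIntegral_comp_comm hint).symm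
  have h2 := ((ContinuousLinearMap.proj (R := ℂ) (φ := fun _ : Fin 2 => ℂ) i).intervalIntegral_comp_comm hint').symm
  simp only [ContinuousLinearMap.proj_apply] at h1 h2
  unfold sheetAmps
  rw [h1, h2, ← intervalIntegral.intervalIntegral_conj]
  refine intervalIntegral.integral_congr fun s _ => ?_
  have := congrFun (duhamelIntegrand_neg_neg_nosheet ha0 β θ s (modeProfile β K c)) i
  simp only [Pi.star_apply, Complex.star_def] at this
  exact this

/-- **The zero line creates nothing** (the forcing carries the factor `2πa`). -/
theorem sheetAmps_zero_line (b θ : ℝ) (st : LamState) : sheetAmps 0 b θ st = 0 := by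
  have hf : ∀ s : ℝ, forcing 0 b st s = 0 := by
    intro s; funext i
    simp only [forcing, mul_zero, Complex.ofReal_zero, zero_mul, Pi.zero_apply]
    fin_cases i <;> simp
  unfold sheetAmps
  simp only [hf, Matrix.mulVec_zero, intervalIntegral.integral_zero]

/-- The (level-stripped) LATTICE LINE ENERGY of a straight sheet pair with amplitudes `q` on the line `a`, Bloch offset `b`, window `K`:
`Σ_{|n| ≤ K} ‖q₀e^{−iπ(b+n)/2} + q₁e^{iπ(b+n)/2}‖²/(a² + (b+n)²)` — one row of `cEnergy (hPairState …)`, one column of `cEnergy (vPairState …)`, times `4π²4^ℓ`. -/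
def lineEnergyOut (a b : ℝ) (K : ℕ) (q : Fin 2 → ℂ) : ℝ :=
  ∑ n ∈ win K, ‖q 0 * Complex.exp (-(Real.pi * (b + n) / 2 : ℝ) * Complex.I) + q 1 * Complex.exp ((Real.pi * (b + n) / 2 : ℝ) * Complex.I)‖ ^ 2 /
    (a ^ 2 + (b + n) ^ 2)

/-- **B1 AS ONE PROP — the CORE-LINE CREATION LAW on the unit strip, exact energy form, constant `C`:** on every line `|a| < 1`, for every Bloch offset
`b ∈ [0,1]`, strain `θ ∈ [0,8]`, window `K` and profile `c`, the lattice line energy of the created straight pair is at most `C ×` the line's input energy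
`Σ_{|n| ≤ K} ‖c n‖²/(a² + (b+n)²)` (uniformity in `K`, in `b`, and in `a → 0⁺` is the content; the zero line itself creates nothing). -/
def CoreLineLaw (C : ℝ) : Prop :=
  ∀ (a b θ : ℝ) (K : ℕ) (c : ℤ → ℂ), |a| < 1 → 0 ≤ b → b ≤ 1 → 0 ≤ θ → θ ≤ 8 →
    lineEnergyOut a b K (sheetAmps a b θ ⟨modeProfile b K c, []⟩) ≤ C * ∑ n ∈ win K, ‖c n‖ ^ 2 / (a ^ 2 + (b + n) ^ 2)


/-- The empty pair has no line energy. -/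
theorem lineEnergyOut_zero (a b : ℝ) (K : ℕ) : lineEnergyOut a b K 0 = 0 := by
  unfold lineEnergyOut; simp

/-- **The CORNER-STRIP law** (what remains of B1 after this file, for any chosen `a₀ ∈ (0, 1]`): the exact line-energy creation law on `|a| < a₀`. -/
def CoreStripLaw (a₀ C : ℝ) : Prop :=
  ∀ (a b θ : ℝ) (K : ℕ) (c : ℤ → ℂ), |a| < a₀ → 0 ≤ b → b ≤ 1 → 0 ≤ θ → θ ≤ 8 →
    lineEnergyOut a b K (sheetAmps a b θ ⟨modeProfile b K c, []⟩) ≤ C * ∑ n ∈ win K, ‖c n‖ ^ 2 / (a ^ 2 + (b + n) ^ 2)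

/-! ## §1 (p2 g13) `β`-periodicity of the typed objects (for the window shift `b ↦ b − 1` on `b ∈ (½, 1]`) -/

/-- `e^{2πi(β+1)} = e^{2πiβ}`. -/
theorem cexp_two_pi_add_one (β : ℝ) :
    Complex.exp (2 * Real.pi * (((β + 1 : ℝ)) : ℂ) * Complex.I) = Complex.exp (2 * Real.pi * (β : ℂ) * Complex.I) := by
  push_cast
  rw [show 2 * (Real.pi : ℂ) * ((β : ℂ) + 1) * Complex.I = 2 * Real.pi * β * Complex.I + 2 * Real.pi * Complex.I by ring, Complex.exp_add,
    Complex.exp_two_pi_mul_I, mul_one]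

/-- The kernel is `1`-periodic in the Bloch phase. -/
theorem lineKernel_add_one (a β y : ℝ) : lineKernel a (β + 1) y = lineKernel a β y := by
  have h1 := cexp_two_pi_add_one β
  have h2 : Complex.exp (2 * Real.pi * (((β + 1 : ℝ)) : ℂ) * (⌊y⌋ : ℝ) * Complex.I) = Complex.exp (2 * Real.pi * (β : ℂ) * (⌊y⌋ : ℝ) * Complex.I) := by
    push_cast
    rw [show 2 * (Real.pi : ℂ) * ((β : ℂ) + 1) * ((⌊y⌋ : ℤ) : ℂ) * Complex.I =
        2 * Real.pi * β * ((⌊y⌋ : ℤ) : ℂ) * Complex.I + ((⌊y⌋ : ℤ) : ℂ) * (2 * Real.pi * Complex.I) by ring,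
      Complex.exp_add, Complex.exp_int_mul_two_pi_mul_I, mul_one]
  simp only [lineKernel]
  rw [h1, h2]

/-- `Σ₀` is `1`-periodic in the Bloch phase. -/
theorem sawSigma0_add_one (k β : ℝ) : sawSigma0 k (β + 1) = sawSigma0 k β := by
  unfold sawSigma0
  rw [show 2 * Real.pi * (β + 1) = 2 * Real.pi * β + 2 * Real.pi by ring, Real.cos_add_two_pi]

/-- `S` is `1`-periodic in the Bloch phase. -/
theorem sawS_add_one (k β : ℝ) : sawS k (β + 1) = sawS k β := by
  have h : Complex.exp (((2 * Real.pi * (β + 1) : ℝ) : ℂ) * Complex.I) = Complex.exp (((2 * Real.pi * β : ℝ) : ℂ) * Complex.I) := by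
    rw [show ((2 * Real.pi * (β + 1) : ℝ) : ℂ) * Complex.I = ((2 * Real.pi * β : ℝ) : ℂ) * Complex.I + 2 * Real.pi * Complex.I by push_cast; ring,
      Complex.exp_add, Complex.exp_two_pi_mul_I, mul_one]
  simp only [sawS]
  rw [h]

/-- `c²`, `λ`, the propagator scalars, the block, the propagator, the forcing and the created amplitudes are `1`-periodic in the Bloch phase. -/
theorem sawC2_add_one (k β : ℝ) : sawC2 k (β + 1) = sawC2 k β := by
  unfold sawC2; rw [sawSigma0_add_one, sawS_add_one]

theorem khLam_add_one (a β : ℝ) : khLam a (β + 1) = khLam a β := by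
  unfold khLam; rw [sawC2_add_one]

theorem propC_add_one (a β t : ℝ) : propC a (β + 1) t = propC a β t := by
  simp only [propC, khLam_add_one]

theorem propSn_add_one (a β t : ℝ) : propSn a (β + 1) t = propSn a β t := by
  simp only [propSn, khLam_add_one]

theorem blockX_add_one (a β : ℝ) : blockX a (β + 1) = blockX a β := by
  simp only [blockX, lineKernel_add_one]

theorem propagator_add_one (a β t : ℝ) : propagator a (β + 1) t = propagator a β t := by
  simp only [propagator, propC_add_one, propSn_add_one, blockX_add_one]

theorem forcing_add_one (a β : ℝ) (st : LamState) (s : ℝ) : forcing a (β + 1) st s = forcing a β st s := by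
  simp only [forcing, lineKernel_add_one]

theorem sheetAmps_add_one (a β θ : ℝ) (st : LamState) : sheetAmps a (β + 1) θ st = sheetAmps a β θ st := by
  simp only [sheetAmps, propagator_add_one, forcing_add_one]

theorem sheetAmps_sub_one (a β θ : ℝ) (st : LamState) : sheetAmps a (β - 1) θ st = sheetAmps a β θ st := by
  rw [← sheetAmps_add_one a (β - 1), sub_add_cancel]

/-! ## §2 (p2 g13) The window shift: the law at `(a, b − 1, K + 1)` gives the law at `(a, b, K)` -/

/-- The coefficient row shifted by one lattice step (window `K ↦ K + 1`). -/
def shiftCoef (K : ℕ) (c : ℤ → ℂ) : ℤ → ℂ := fun m => if m - 1 ∈ win K then c (m - 1) else 0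

theorem mem_win_succ_of {K : ℕ} {n : ℤ} (hn : n ∈ win K) : n + 1 ∈ win (K + 1) := by
  simp only [win, Finset.mem_Icc] at hn ⊢; push_cast; omega

theorem map_win_subset (K : ℕ) : (win K).map (addRightEmbedding (1 : ℤ)) ⊆ win (K + 1) := by
  intro m hm
  rw [Finset.mem_map] at hm
  obtain ⟨n, hn, rfl⟩ := hm
  exact mem_win_succ_of hn

/-- A sum over the shifted window of a function vanishing off the image of the shift. -/
theorem sum_win_shift {M : Type*} [AddCommMonoid M] (K : ℕ) (g : ℤ → M) (hg : ∀ m ∈ win (K + 1), m - 1 ∉ win K → g m = 0) :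
    ∑ m ∈ win (K + 1), g m = ∑ n ∈ win K, g (n + 1) := by
  rw [← Finset.sum_subset (map_win_subset K) (fun m hm hnot => hg m hm (fun h => hnot ?_)), Finset.sum_map]
  · rfl
  · rw [Finset.mem_map]; exact ⟨m - 1, h, by simp⟩

/-- The profile of the class `b` at window `K` IS the profile of the class `b − 1` at window `K + 1` with shifted coefficients. -/
theorem modeProfile_shift (b : ℝ) (K : ℕ) (c : ℤ → ℂ) : modeProfile b K c = modeProfile (b - 1) (K + 1) (shiftCoef K c) := by
  funext y
  simp only [modeProfile]
  rw [sum_win_shift K _ (fun m _ hm => by simp [shiftCoef, hm])]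
  refine Finset.sum_congr rfl fun n hn => ?_
  simp only [shiftCoef, add_sub_cancel_right, if_pos hn]
  congr 2; push_cast; ring

/-- The input energy is unchanged by the shift. -/
theorem energyIn_shift (a b : ℝ) (K : ℕ) (c : ℤ → ℂ) :
    ∑ m ∈ win (K + 1), ‖shiftCoef K c m‖ ^ 2 / (a ^ 2 + (b - 1 + m) ^ 2) = ∑ n ∈ win K, ‖c n‖ ^ 2 / (a ^ 2 + (b + n) ^ 2) := by
  rw [sum_win_shift K _ (fun m _ hm => by simp [shiftCoef, hm])]
  refine Finset.sum_congr rfl fun n hn => ?_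
  simp only [shiftCoef, add_sub_cancel_right, if_pos hn]
  push_cast; ring_nf

/-- The output line energy only grows under the shift (the window gains two columns). -/
theorem lineEnergyOut_shift_le (a b : ℝ) (K : ℕ) (q : Fin 2 → ℂ) :
    lineEnergyOut a b K q ≤ lineEnergyOut a (b - 1) (K + 1) q := by
  unfold lineEnergyOut
  have e : ∀ n : ℤ, ‖q 0 * Complex.exp (-(Real.pi * (b + n) / 2 : ℝ) * Complex.I) + q 1 * Complex.exp ((Real.pi * (b + n) / 2 : ℝ) * Complex.I)‖ ^ 2 /
        (a ^ 2 + (b + n) ^ 2) =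
      ‖q 0 * Complex.exp (-(Real.pi * (b - 1 + ((n + 1 : ℤ) : ℝ)) / 2 : ℝ) * Complex.I) + q 1 * Complex.exp ((Real.pi * (b - 1 + ((n + 1 : ℤ) : ℝ)) / 2 : ℝ) * Complex.I)‖ ^ 2 /
        (a ^ 2 + (b - 1 + ((n + 1 : ℤ) : ℝ)) ^ 2) := by
    intro n; push_cast; ring_nf
  calc ∑ n ∈ win K, ‖q 0 * Complex.exp (-(Real.pi * (b + n) / 2 : ℝ) * Complex.I) + q 1 * Complex.exp ((Real.pi * (b + n) / 2 : ℝ) * Complex.I)‖ ^ 2 /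
          (a ^ 2 + (b + n) ^ 2)
      = ∑ n ∈ win K, ‖q 0 * Complex.exp (-(Real.pi * (b - 1 + ((n + 1 : ℤ) : ℝ)) / 2 : ℝ) * Complex.I) +
            q 1 * Complex.exp ((Real.pi * (b - 1 + ((n + 1 : ℤ) : ℝ)) / 2 : ℝ) * Complex.I)‖ ^ 2 / (a ^ 2 + (b - 1 + ((n + 1 : ℤ) : ℝ)) ^ 2) :=
        Finset.sum_congr rfl fun n _ => e n
    _ = ∑ m ∈ (win K).map (addRightEmbedding (1 : ℤ)), ‖q 0 * Complex.exp (-(Real.pi * (b - 1 + m) / 2 : ℝ) * Complex.I) +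
            q 1 * Complex.exp ((Real.pi * (b - 1 + m) / 2 : ℝ) * Complex.I)‖ ^ 2 / (a ^ 2 + (b - 1 + m) ^ 2) := by
        rw [Finset.sum_map]; rfl
    _ ≤ _ := Finset.sum_le_sum_of_subset_of_nonneg (map_win_subset K) fun _ _ _ => by positivity

/-- **The window shift:** the law (constant `C`) for `(a, b − 1)` at window `K + 1` and shifted coefficients gives the law for `(a, b)` at window `K`. -/
theorem lineLaw_of_shift {a b θ C : ℝ} {K : ℕ} {c : ℤ → ℂ}
    (h : lineEnergyOut a (b - 1) (K + 1) (sheetAmps a (b - 1) θ ⟨modeProfile (b - 1) (K + 1) (shiftCoef K c), []⟩) ≤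
      C * ∑ m ∈ win (K + 1), ‖shiftCoef K c m‖ ^ 2 / (a ^ 2 + (b - 1 + m) ^ 2)) :
    lineEnergyOut a b K (sheetAmps a b θ ⟨modeProfile b K c, []⟩) ≤ C * ∑ n ∈ win K, ‖c n‖ ^ 2 / (a ^ 2 + (b + n) ^ 2) := by
  rw [energyIn_shift] at h
  have hq : sheetAmps a b θ ⟨modeProfile b K c, []⟩ = sheetAmps a (b - 1) θ ⟨modeProfile (b - 1) (K + 1) (shiftCoef K c), []⟩ := by
    rw [← modeProfile_shift, sheetAmps_sub_one]
  rw [hq]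
  exact (lineEnergyOut_shift_le a b K _).trans h

/-! ## §3 (p2 g13) Negative lines: the law at `(−a, −b)` for the reflected conjugated coefficients gives the law at `(a, b)` -/

/-- The output line energy of the conjugated pair at `(a, b)` is that of the pair at `(−a, −b)`. -/
theorem lineEnergyOut_conj (a b : ℝ) (K : ℕ) (q : Fin 2 → ℂ) :
    lineEnergyOut a b K (fun i => starRingEnd ℂ (q i)) = lineEnergyOut (-a) (-b) K q := by
  unfold lineEnergyOut
  refine Finset.sum_nbij' (fun n => -n) (fun n => -n) (fun n hn => by simp only [win, Finset.mem_Icc] at hn ⊢; omega)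
    (fun n hn => by simp only [win, Finset.mem_Icc] at hn ⊢; omega) (fun n _ => neg_neg n) (fun n _ => neg_neg n) (fun n _ => ?_)
  have e : starRingEnd ℂ (q 0) * Complex.exp (-(Real.pi * (b + n) / 2 : ℝ) * Complex.I) + starRingEnd ℂ (q 1) * Complex.exp ((Real.pi * (b + n) / 2 : ℝ) * Complex.I) =
      starRingEnd ℂ (q 0 * Complex.exp (-(Real.pi * (-b + ((-n : ℤ) : ℝ)) / 2 : ℝ) * Complex.I) + q 1 * Complex.exp ((Real.pi * (-b + ((-n : ℤ) : ℝ)) / 2 : ℝ) * Complex.I)) := by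
    simp only [map_add, map_mul, ← Complex.exp_conj, map_neg, Complex.conj_ofReal, Complex.conj_I]
    congr 3
    · push_cast; ring
    · push_cast; ring
  rw [e, Complex.norm_conj]
  congr 1
  push_cast; ring

/-- **Conjugation:** the law (constant `C`) for `(−a, −b)` and coefficients `n ↦ conj (c (−n))` gives the law for `(a, b)` and `c` (`a < 0`). -/
theorem lineLaw_of_conj {a b θ C : ℝ} {K : ℕ} {c : ℤ → ℂ} (ha : a < 0)
    (h : lineEnergyOut (-a) (-b) K (sheetAmps (-a) (-b) θ ⟨modeProfile (-b) K (fun n => starRingEnd ℂ (c (-n))), []⟩) ≤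
      C * ∑ n ∈ win K, ‖starRingEnd ℂ (c (-n))‖ ^ 2 / ((-a) ^ 2 + (-b + n) ^ 2)) :
    lineEnergyOut a b K (sheetAmps a b θ ⟨modeProfile b K c, []⟩) ≤ C * ∑ n ∈ win K, ‖c n‖ ^ 2 / (a ^ 2 + (b + n) ^ 2) := by
  have ha' : 0 < -a := by linarith
  have hq : ∀ i, sheetAmps a b θ ⟨modeProfile b K c, []⟩ i =
      starRingEnd ℂ (sheetAmps (-a) (-b) θ ⟨modeProfile (-b) K (fun n => starRingEnd ℂ (c (-n))), []⟩ i) := by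
    intro i
    have h1 := sheetAmps_neg_neg_modeProfile_pos ha' (-b) θ K (fun n => starRingEnd ℂ (c (-n))) i
    simp only [neg_neg, Complex.conj_conj] at h1
    exact h1
  have hE : lineEnergyOut a b K (sheetAmps a b θ ⟨modeProfile b K c, []⟩) =
      lineEnergyOut (-a) (-b) K (sheetAmps (-a) (-b) θ ⟨modeProfile (-b) K (fun n => starRingEnd ℂ (c (-n))), []⟩) := by
    rw [← lineEnergyOut_conj]
    congr 1
    funext i
    exact hq i
  have hin : ∑ n ∈ win K, ‖starRingEnd ℂ (c (-n))‖ ^ 2 / ((-a) ^ 2 + (-b + n) ^ 2) = ∑ n ∈ win K, ‖c n‖ ^ 2 / (a ^ 2 + (b + n) ^ 2) := by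
    refine Finset.sum_nbij' (fun n => -n) (fun n => -n) (fun n hn => by simp only [win, Finset.mem_Icc] at hn ⊢; omega)
      (fun n hn => by simp only [win, Finset.mem_Icc] at hn ⊢; omega) (fun n _ => neg_neg n) (fun n _ => neg_neg n) (fun n _ => ?_)
    rw [Complex.norm_conj]
    push_cast; ring
  rw [hE]
  rw [hin] at h
  exact h

/-! ## §4 (p2 g13) The derivative kernel and the Duhamel integrand in the kink-pair frame -/

/-- The derivative of the closed form of the kernel on one period (`…KHKernelBlochDeriv`, hypothesis `hK'`). -/
def kernelK' (a β : ℝ) : ℝ → ℂ := fun r : ℝ => ((Real.exp (-(2 * Real.pi * a * r)) : ℂ) /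
            (1 - starRingEnd ℂ (Complex.exp (2 * Real.pi * β * Complex.I)) * (Real.exp (-(2 * Real.pi * a)) : ℂ))
          - (Real.exp (2 * Real.pi * a * (r - 1)) : ℂ) * Complex.exp (2 * Real.pi * β * Complex.I) /
            (1 - Complex.exp (2 * Real.pi * β * Complex.I) * (Real.exp (-(2 * Real.pi * a)) : ℂ))) / 2

/-- The derivative of the Bloch kernel off the lattice (`…KHKernelBlochDeriv`, hypothesis `hG'`). -/
def lineKernel' (a β : ℝ) : ℝ → ℂ := fun u : ℝ => Complex.exp (2 * Real.pi * β * (⌊u⌋ : ℝ) * Complex.I) * kernelK' a β (u - ⌊u⌋)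

/-- The frame coefficient `x_vu = 2πia(−¼ − 2G(0) + 2Ḡ(½)e^{iπβ})` (pole-free). -/
def frameVU (a β : ℝ) : ℂ :=
  (((2 * Real.pi * a : ℝ) : ℂ) * Complex.I) *
    (-(1 / 4 : ℂ) - 2 * lineKernel a β 0 + 2 * starRingEnd ℂ (lineKernel a β (1 / 2)) * Complex.exp (((Real.pi * β : ℝ) : ℂ) * Complex.I))

/-- The frame coefficient `x_uv = 2πia(−¼ − 2G(0) − 2Ḡ(½)e^{iπβ})` (carries the pole). -/
def frameUV (a β : ℝ) : ℂ :=
  (((2 * Real.pi * a : ℝ) : ℂ) * Complex.I) *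
    (-(1 / 4 : ℂ) - 2 * lineKernel a β 0 - 2 * starRingEnd ℂ (lineKernel a β (1 / 2)) * Complex.exp (((Real.pi * β : ℝ) : ℂ) * Complex.I))

/-- `‖x_vu‖ ≤ 3πa/2` for `|β| ≤ ½` (tree `norm_frameCoef_vu_le`: the poles cancel). -/
theorem norm_frameVU_le {a : ℝ} (ha : 0 < a) {β : ℝ} (hβ : |β| ≤ 1 / 2) : ‖frameVU a β‖ ≤ a * (3 * Real.pi / 2) := by
  have h := (frameCoef_eq (twoPi_lineKernel_zero' ha β) (twoPi_conj_lineKernel_half' ha β)).1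
  unfold frameVU
  rw [h, norm_mul, norm_mul, Complex.norm_I, one_mul, Complex.norm_real, Real.norm_eq_abs, abs_of_pos ha]
  exact mul_le_mul_of_nonneg_left (norm_frameCoef_vu_le ha hβ) ha.le

/-- `‖x_uv‖ ≤ a(π/2 + 2(1+q)/(a(1−q)))` (tree `norm_frameCoef_uv_le`). -/
theorem norm_frameUV_le {a : ℝ} (ha : 0 < a) (β : ℝ) : ‖frameUV a β‖ ≤ a * (Real.pi / 2 + 2 * (1 + sawQ a) / (a * (1 - sawQ a))) := by
  have h := (frameCoef_eq (twoPi_lineKernel_zero' ha β) (twoPi_conj_lineKernel_half' ha β)).2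
  unfold frameUV
  rw [h, norm_mul, norm_mul, Complex.norm_I, one_mul, Complex.norm_real, Real.norm_eq_abs, abs_of_pos ha]
  exact mul_le_mul_of_nonneg_left (norm_frameCoef_uv_le ha β) ha.le

/-- For `0 < a ≤ 1/16`: `4πa·‖x_uv‖ ≤ 17`. -/
theorem four_pi_mul_norm_frameUV_le {a : ℝ} (ha : 0 < a) (ha1 : a ≤ 1 / 16) (β : ℝ) : 4 * Real.pi * a * ‖frameUV a β‖ ≤ 17 := by
  have hπ := Real.pi_pos
  have hπ4 := Real.pi_lt_four
  obtain ⟨_, h1q⟩ := corner_q_bounds ha ha1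
  have hq0 : 0 < sawQ a := sawQ_pos a
  have hq1 : sawQ a < 1 := sawQ_lt_one ha
  have hqe : sawQ a = Real.exp (-(2 * Real.pi * a)) := rfl
  rw [← hqe] at h1q
  have h := norm_frameUV_le ha β
  have h2 : 2 * (1 + sawQ a) / (a * (1 - sawQ a)) ≤ 4 / (a * (Real.pi * a)) := by
    rw [div_le_div_iff₀ (by nlinarith) (by positivity)]
    have : 2 * (1 + sawQ a) * (Real.pi * a) ≤ 4 * (1 - sawQ a) := by nlinarith
    nlinarith [this, ha]
  calc 4 * Real.pi * a * ‖frameUV a β‖ ≤ 4 * Real.pi * a * (a * (Real.pi / 2 + 4 / (a * (Real.pi * a)))) := by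
        refine mul_le_mul_of_nonneg_left (h.trans ?_) (by positivity)
        exact mul_le_mul_of_nonneg_left (by linarith) ha.le
    _ = 2 * Real.pi ^ 2 * a ^ 2 + 16 := by field_simp; ring
    _ ≤ 17 := by
        have ha2 : a ^ 2 ≤ (1 / 16) ^ 2 := pow_le_pow_left₀ ha.le ha1 2
        have hp2 : Real.pi ^ 2 ≤ 4 ^ 2 := pow_le_pow_left₀ hπ.le hπ4.le 2
        nlinarith [mul_le_mul hp2 ha2 (sq_nonneg _) (by norm_num)]

/-- The component `i` of the propagator acting on a vector: `(P(t)f)_i = C(t) f_i + Sn(t) (Xf)_i`. -/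
theorem propagator_mulVec_apply (a β t : ℝ) (f : Fin 2 → ℂ) (i : Fin 2) :
    (propagator a β t).mulVec f i = ((propC a β t : ℝ) : ℂ) * f i + ((propSn a β t : ℝ) : ℂ) * (blockX a β).mulVec f i := by
  simp only [propagator, Matrix.add_mulVec, Matrix.smul_mulVec, Matrix.one_mulVec, Pi.add_apply, Pi.smul_apply, smul_eq_mul]

/-- **The Duhamel integrand in the frame, `U` component:** `(Pf)₀e^{−iπβ/2} + (Pf)₁e^{iπβ/2} = C(t)·U(f) + Sn(t)·x_vu·V(f)`. -/
theorem duhamel_frame_U {a : ℝ} (ha : 0 < a) (β t : ℝ) (f : Fin 2 → ℂ) :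
    (propagator a β t).mulVec f 0 * Complex.exp (-((Real.pi * β / 2 : ℝ) : ℂ) * Complex.I) +
        (propagator a β t).mulVec f 1 * Complex.exp (((Real.pi * β / 2 : ℝ) : ℂ) * Complex.I) =
      ((propC a β t : ℝ) : ℂ) * (f 0 * Complex.exp (-((Real.pi * β / 2 : ℝ) : ℂ) * Complex.I) + f 1 * Complex.exp (((Real.pi * β / 2 : ℝ) : ℂ) * Complex.I)) +
        ((propSn a β t : ℝ) : ℂ) * (frameVU a β *
          (f 0 * Complex.exp (-((Real.pi * β / 2 : ℝ) : ℂ) * Complex.I) - f 1 * Complex.exp (((Real.pi * β / 2 : ℝ) : ℂ) * Complex.I))) := by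
  have hrel := frame_rel_of ha (twoPi_conj_lineKernel_half' ha β)
  have hX := frame_mulVec_U a β (G0 := lineKernel a β 0) hrel f
  rw [propagator_mulVec_apply, propagator_mulVec_apply]
  unfold frameVU
  simp only [blockX] at hX ⊢
  linear_combination (((propSn a β t : ℝ) : ℂ)) * hX

/-- **The Duhamel integrand in the frame, `V` component:** `(Pf)₀e^{−iπβ/2} − (Pf)₁e^{iπβ/2} = C(t)·V(f) + Sn(t)·x_uv·U(f)`. -/
theorem duhamel_frame_V {a : ℝ} (ha : 0 < a) (β t : ℝ) (f : Fin 2 → ℂ) :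
    (propagator a β t).mulVec f 0 * Complex.exp (-((Real.pi * β / 2 : ℝ) : ℂ) * Complex.I) -
        (propagator a β t).mulVec f 1 * Complex.exp (((Real.pi * β / 2 : ℝ) : ℂ) * Complex.I) =
      ((propC a β t : ℝ) : ℂ) * (f 0 * Complex.exp (-((Real.pi * β / 2 : ℝ) : ℂ) * Complex.I) - f 1 * Complex.exp (((Real.pi * β / 2 : ℝ) : ℂ) * Complex.I)) +
        ((propSn a β t : ℝ) : ℂ) * (frameUV a β *
          (f 0 * Complex.exp (-((Real.pi * β / 2 : ℝ) : ℂ) * Complex.I) + f 1 * Complex.exp (((Real.pi * β / 2 : ℝ) : ℂ) * Complex.I))) := by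
  have hrel := frame_rel_of ha (twoPi_conj_lineKernel_half' ha β)
  have hX := frame_mulVec_V a β (G0 := lineKernel a β 0) hrel f
  rw [propagator_mulVec_apply, propagator_mulVec_apply]
  unfold frameUV
  simp only [blockX] at hX ⊢
  linear_combination (((propSn a β t : ℝ) : ℂ)) * hX

/-! ## §5 (p2 g13) The single-mode forcing in the frame: the two kink-pair sources as duality integrals -/

/-- `U(f) = 2·(2πia)·∫ F_U e^{2πi(β+n)y}` for the single mode `β + n`. -/
theorem forcing_frame_U {a : ℝ} (ha : 0 < a) (β : ℝ) (n : ℤ) (s : ℝ) :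
    forcing a β (singleMode (β + n)) s 0 * Complex.exp (-((Real.pi * β / 2 : ℝ) : ℂ) * Complex.I) +
        forcing a β (singleMode (β + n)) s 1 * Complex.exp (((Real.pi * β / 2 : ℝ) : ℂ) * Complex.I) =
      2 * ((2 * Real.pi * a : ℝ) * Complex.I : ℂ) *
        ∫ y in (-(1 / 2 : ℝ))..(1 / 2),
          ((-lineKernel a β (1 / 4 - y) * Complex.exp (-((Real.pi * β / 2 : ℝ) : ℂ) * Complex.I) +
              lineKernel a β (-(1 / 4) - y) * Complex.exp (((Real.pi * β / 2 : ℝ) : ℂ) * Complex.I)) *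
            Complex.exp (-((2 * Real.pi * a * s * triWave y : ℝ) : ℂ) * Complex.I)) *
          Complex.exp ((2 * Real.pi * (β + n) * y : ℝ) * Complex.I) := by
  have hI1 := forcingIntegrand_intervalIntegrable_quarter ha β (β + n) s (K := kernelK a β) (G := lineKernel a β) rfl (lineKernel_eq ha β)
  have hI2 := forcingIntegrand_intervalIntegrable_negQuarter ha β (β + n) s (K := kernelK a β) (G := lineKernel a β) rfl (lineKernel_eq ha β)
  rw [forcing_singleMode]
  simp only [Fin.isValue, Matrix.cons_val_zero, Matrix.cons_val_one, Matrix.cons_val_fin_one, src]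
  rw [show ((2 * Real.pi * a : ℝ) * Complex.I : ℂ) * (-2) *
        (∫ y in (-(1 / 2 : ℝ))..(1 / 2 : ℝ), lineKernel a β (1 / 4 - y) * Complex.exp (((2 * Real.pi * (β + n) * y : ℝ) : ℂ) * Complex.I) *
          Complex.exp (-((2 * Real.pi * a * s * triWave y : ℝ) : ℂ) * Complex.I)) * Complex.exp (-((Real.pi * β / 2 : ℝ) : ℂ) * Complex.I) +
      ((2 * Real.pi * a : ℝ) * Complex.I : ℂ) * 2 *
        (∫ y in (-(1 / 2 : ℝ))..(1 / 2 : ℝ), lineKernel a β (-(1 / 4) - y) * Complex.exp (((2 * Real.pi * (β + n) * y : ℝ) : ℂ) * Complex.I) *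
          Complex.exp (-((2 * Real.pi * a * s * triWave y : ℝ) : ℂ) * Complex.I)) * Complex.exp (((Real.pi * β / 2 : ℝ) : ℂ) * Complex.I) =
      2 * ((2 * Real.pi * a : ℝ) * Complex.I : ℂ) *
        ((-Complex.exp (-((Real.pi * β / 2 : ℝ) : ℂ) * Complex.I)) *
          (∫ y in (-(1 / 2 : ℝ))..(1 / 2 : ℝ), lineKernel a β (1 / 4 - y) * Complex.exp (((2 * Real.pi * (β + n) * y : ℝ) : ℂ) * Complex.I) *
            Complex.exp (-((2 * Real.pi * a * s * triWave y : ℝ) : ℂ) * Complex.I)) +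
          Complex.exp (((Real.pi * β / 2 : ℝ) : ℂ) * Complex.I) *
          (∫ y in (-(1 / 2 : ℝ))..(1 / 2 : ℝ), lineKernel a β (-(1 / 4) - y) * Complex.exp (((2 * Real.pi * (β + n) * y : ℝ) : ℂ) * Complex.I) *
            Complex.exp (-((2 * Real.pi * a * s * triWave y : ℝ) : ℂ) * Complex.I))) by ring]
  congr 1
  rw [← intervalIntegral.integral_const_mul, ← intervalIntegral.integral_const_mul, ← intervalIntegral.integral_add (hI1.const_mul _) (hI2.const_mul _)]
  refine intervalIntegral.integral_congr fun y _ => ?_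
  ring

/-- `V(f) = 2·(2πia)·∫ F_V e^{2πi(β+n)y}` for the single mode `β + n`. -/
theorem forcing_frame_V {a : ℝ} (ha : 0 < a) (β : ℝ) (n : ℤ) (s : ℝ) :
    forcing a β (singleMode (β + n)) s 0 * Complex.exp (-((Real.pi * β / 2 : ℝ) : ℂ) * Complex.I) -
        forcing a β (singleMode (β + n)) s 1 * Complex.exp (((Real.pi * β / 2 : ℝ) : ℂ) * Complex.I) =
      2 * ((2 * Real.pi * a : ℝ) * Complex.I : ℂ) *
        ∫ y in (-(1 / 2 : ℝ))..(1 / 2),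
          ((-lineKernel a β (1 / 4 - y) * Complex.exp (-((Real.pi * β / 2 : ℝ) : ℂ) * Complex.I) -
              lineKernel a β (-(1 / 4) - y) * Complex.exp (((Real.pi * β / 2 : ℝ) : ℂ) * Complex.I)) *
            Complex.exp (-((2 * Real.pi * a * s * triWave y : ℝ) : ℂ) * Complex.I)) *
          Complex.exp ((2 * Real.pi * (β + n) * y : ℝ) * Complex.I) := by
  have hI1 := forcingIntegrand_intervalIntegrable_quarter ha β (β + n) s (K := kernelK a β) (G := lineKernel a β) rfl (lineKernel_eq ha β)
  have hI2 := forcingIntegrand_intervalIntegrable_negQuarter ha β (β + n) s (K := kernelK a β) (G := lineKernel a β) rfl (lineKernel_eq ha β)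
  rw [forcing_singleMode]
  simp only [Fin.isValue, Matrix.cons_val_zero, Matrix.cons_val_one, Matrix.cons_val_fin_one, src]
  rw [show ((2 * Real.pi * a : ℝ) * Complex.I : ℂ) * (-2) *
        (∫ y in (-(1 / 2 : ℝ))..(1 / 2 : ℝ), lineKernel a β (1 / 4 - y) * Complex.exp (((2 * Real.pi * (β + n) * y : ℝ) : ℂ) * Complex.I) *
          Complex.exp (-((2 * Real.pi * a * s * triWave y : ℝ) : ℂ) * Complex.I)) * Complex.exp (-((Real.pi * β / 2 : ℝ) : ℂ) * Complex.I) -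
      ((2 * Real.pi * a : ℝ) * Complex.I : ℂ) * 2 *
        (∫ y in (-(1 / 2 : ℝ))..(1 / 2 : ℝ), lineKernel a β (-(1 / 4) - y) * Complex.exp (((2 * Real.pi * (β + n) * y : ℝ) : ℂ) * Complex.I) *
          Complex.exp (-((2 * Real.pi * a * s * triWave y : ℝ) : ℂ) * Complex.I)) * Complex.exp (((Real.pi * β / 2 : ℝ) : ℂ) * Complex.I) =
      2 * ((2 * Real.pi * a : ℝ) * Complex.I : ℂ) *
        ((-Complex.exp (-((Real.pi * β / 2 : ℝ) : ℂ) * Complex.I)) *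
          (∫ y in (-(1 / 2 : ℝ))..(1 / 2 : ℝ), lineKernel a β (1 / 4 - y) * Complex.exp (((2 * Real.pi * (β + n) * y : ℝ) : ℂ) * Complex.I) *
            Complex.exp (-((2 * Real.pi * a * s * triWave y : ℝ) : ℂ) * Complex.I)) +
          (-Complex.exp (((Real.pi * β / 2 : ℝ) : ℂ) * Complex.I)) *
          (∫ y in (-(1 / 2 : ℝ))..(1 / 2 : ℝ), lineKernel a β (-(1 / 4) - y) * Complex.exp (((2 * Real.pi * (β + n) * y : ℝ) : ℂ) * Complex.I) *
            Complex.exp (-((2 * Real.pi * a * s * triWave y : ℝ) : ℂ) * Complex.I))) by ring]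
  congr 1
  rw [← intervalIntegral.integral_const_mul, ← intervalIntegral.integral_const_mul, ← intervalIntegral.integral_add (hI1.const_mul _) (hI2.const_mul _)]
  refine intervalIntegral.integral_congr fun y _ => ?_
  ring

/-! ## §6 (p2 g13) The roof and the pointwise bound of the Duhamel integrand of a profile -/

/-- `sawSigmaStar > 0`. -/
theorem sawSigmaStar_pos : 0 < sawSigmaStar := by unfold sawSigmaStar; norm_num

/-- **The roof on every line:** `|C(t)| ≤ cosh(8σ⋆)`, `|Sn(t)| ≤ 8·cosh(8σ⋆)` for `0 ≤ t ≤ θ ≤ 8` (`λ₊ ≤ σ⋆²`, tree `sq_mul_neg_sawC2_le_sawSigmaStar_sq`). -/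
theorem roof {a : ℝ} (ha : 0 < a) (β : ℝ) {t θ : ℝ} (ht : 0 ≤ t) (htθ : t ≤ θ) (hθ : θ ≤ 8) :
    |propC a β t| ≤ Real.cosh (8 * sawSigmaStar) ∧ |propSn a β t| ≤ 8 * Real.cosh (8 * sawSigmaStar) := by
  have hσ := sawSigmaStar_pos
  have hθ0 : 0 ≤ θ := ht.trans htθ
  have hΛ : max 0 (khLam a β) ≤ sawSigmaStar ^ 2 := by
    refine max_le (sq_nonneg _) ?_
    have := sq_mul_neg_sawC2_le_sawSigmaStar_sq ha β
    unfold khLam; linarith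
  have hs : Real.sqrt (max 0 (khLam a β)) * θ ≤ sawSigmaStar * 8 := by
    have h1 : Real.sqrt (max 0 (khLam a β)) ≤ sawSigmaStar := by
      rw [← Real.sqrt_sq hσ.le]; exact Real.sqrt_le_sqrt hΛ
    exact mul_le_mul h1 hθ hθ0 hσ.le
  have hcosh : Real.cosh (Real.sqrt (max 0 (khLam a β)) * θ) ≤ Real.cosh (8 * sawSigmaStar) := by
    rw [Real.cosh_le_cosh, abs_of_nonneg (by positivity), abs_of_nonneg (by positivity)]
    linarith
  refine ⟨(abs_propC_le a β ht htθ).trans hcosh, (abs_propSn_le a β ht htθ).trans ?_⟩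
  exact mul_le_mul hθ hcosh (Real.cosh_pos _).le (by norm_num)

/-- `‖2·(2πia)‖ = 4πa`. -/
theorem norm_two_mul_sigma {a : ℝ} (ha : 0 < a) : ‖(2 : ℂ) * ((2 * Real.pi * a : ℝ) * Complex.I : ℂ)‖ = 4 * Real.pi * a := by
  rw [norm_mul, norm_mul, Complex.norm_real, Complex.norm_I, Real.norm_eq_abs, abs_of_pos (by positivity)]
  norm_num; ring

/-- **Pointwise bound, `U` component:** for `0 < a ≤ 1/16`, `|β| ≤ ½`, `0 ≤ s ≤ θ ≤ 8` and every profile,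
`‖Σ_n c_n U-component of P(θ−s) f_n(s)‖ ≤ a·√E_in·cosh(8σ⋆)·4π(√2 + 12π)`. -/
theorem duhamel_sum_U_le {a : ℝ} (ha : 0 < a) (ha1 : a ≤ 1 / 16) {β : ℝ} (hβ : |β| ≤ 1 / 2) {θ s : ℝ} (hs0 : 0 ≤ s) (hsθ : s ≤ θ)
    (hθ : θ ≤ 8) (K : ℕ) (c : ℤ → ℂ) :
    ‖∑ n ∈ win K, c n * ((propagator a β (θ - s)).mulVec (forcing a β (singleMode (β + n)) s) 0 * Complex.exp (-((Real.pi * β / 2 : ℝ) : ℂ) * Complex.I) +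
        (propagator a β (θ - s)).mulVec (forcing a β (singleMode (β + n)) s) 1 * Complex.exp (((Real.pi * β / 2 : ℝ) : ℂ) * Complex.I))‖ ≤
      a * Real.sqrt (∑ n ∈ win K, ‖c n‖ ^ 2 / (a ^ 2 + (β + n) ^ 2)) * (Real.cosh (8 * sawSigmaStar) * (4 * Real.pi) * (Real.sqrt 2 + 12 * Real.pi)) := by
  set E : ℝ := ∑ n ∈ win K, ‖c n‖ ^ 2 / (a ^ 2 + (β + n) ^ 2) with hE
  set M₀ : ℝ := Real.cosh (8 * sawSigmaStar) with hM₀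
  set σ₂ : ℂ := 2 * ((2 * Real.pi * a : ℝ) * Complex.I : ℂ) with hσ₂
  have hπ := Real.pi_pos
  have hs8 : s ≤ 8 := hsθ.trans hθ
  -- the two duality integrals per mode
  set dU : ℤ → ℂ := fun n => ∫ y in (-(1 / 2 : ℝ))..(1 / 2),
      ((-lineKernel a β (1 / 4 - y) * Complex.exp (-((Real.pi * β / 2 : ℝ) : ℂ) * Complex.I) +
          lineKernel a β (-(1 / 4) - y) * Complex.exp (((Real.pi * β / 2 : ℝ) : ℂ) * Complex.I)) *
        Complex.exp (-((2 * Real.pi * a * s * triWave y : ℝ) : ℂ) * Complex.I)) * Complex.exp ((2 * Real.pi * (β + n) * y : ℝ) * Complex.I) with hdU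
  set dV : ℤ → ℂ := fun n => ∫ y in (-(1 / 2 : ℝ))..(1 / 2),
      ((-lineKernel a β (1 / 4 - y) * Complex.exp (-((Real.pi * β / 2 : ℝ) : ℂ) * Complex.I) -
          lineKernel a β (-(1 / 4) - y) * Complex.exp (((Real.pi * β / 2 : ℝ) : ℂ) * Complex.I)) *
        Complex.exp (-((2 * Real.pi * a * s * triWave y : ℝ) : ℂ) * Complex.I)) * Complex.exp ((2 * Real.pi * (β + n) * y : ℝ) * Complex.I) with hdV
  -- rewrite each summand in the frame
  have hterm : ∀ n : ℤ, c n * ((propagator a β (θ - s)).mulVec (forcing a β (singleMode (β + n)) s) 0 * Complex.exp (-((Real.pi * β / 2 : ℝ) : ℂ) * Complex.I) +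
        (propagator a β (θ - s)).mulVec (forcing a β (singleMode (β + n)) s) 1 * Complex.exp (((Real.pi * β / 2 : ℝ) : ℂ) * Complex.I)) =
      ((propC a β (θ - s) : ℝ) : ℂ) * σ₂ * (c n * dU n) + ((propSn a β (θ - s) : ℝ) : ℂ) * frameVU a β * σ₂ * (c n * dV n) := by
    intro n
    rw [duhamel_frame_U ha, forcing_frame_U ha, forcing_frame_V ha]
    ring
  rw [Finset.sum_congr rfl fun n _ => hterm n, Finset.sum_add_distrib, ← Finset.mul_sum, ← Finset.mul_sum]
  -- the weighted Bessel sums of the two sources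
  have hSU := corner_sum_U_le ha ha1 hβ hs0 hs8 (K := kernelK a β) (G := lineKernel a β) (K' := kernelK' a β) (G' := lineKernel' a β)
    rfl (lineKernel_eq ha β) rfl (fun u => rfl) (win K)
  have hSV := corner_sum_V_le ha ha1 hβ hs0 hs8 (K := kernelK a β) (G := lineKernel a β) (K' := kernelK' a β) (G' := lineKernel' a β)
    rfl (lineKernel_eq ha β) rfl (fun u => rfl) (win K)
  have hCS_U := norm_sum_mul_le_sqrt_mul_sqrt ha.ne' β c dU (win K)
  have hCS_V := norm_sum_mul_le_sqrt_mul_sqrt ha.ne' β c dV (win K)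
  have hU : ‖∑ n ∈ win K, c n * dU n‖ ≤ Real.sqrt E * Real.sqrt 2 :=
    hCS_U.trans (mul_le_mul_of_nonneg_left (Real.sqrt_le_sqrt hSU) (Real.sqrt_nonneg _))
  have hV : ‖∑ n ∈ win K, c n * dV n‖ ≤ Real.sqrt E * (1 / a) := by
    refine hCS_V.trans (mul_le_mul_of_nonneg_left ((Real.sqrt_le_sqrt hSV).trans (le_of_eq ?_)) (Real.sqrt_nonneg _))
    rw [Real.sqrt_div' _ (sq_nonneg a), Real.sqrt_one, Real.sqrt_sq ha.le]
  -- the roof and the frame coefficient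
  obtain ⟨hC, hS⟩ := roof ha β (show 0 ≤ θ - s by linarith) (show θ - s ≤ θ by linarith) hθ
  have hxvu := norm_frameVU_le ha hβ
  have hσn : ‖σ₂‖ = 4 * Real.pi * a := norm_two_mul_sigma ha
  have hE0 : 0 ≤ Real.sqrt E := Real.sqrt_nonneg _
  have hM1 : 1 ≤ M₀ := Real.one_le_cosh _
  calc ‖((propC a β (θ - s) : ℝ) : ℂ) * σ₂ * ∑ n ∈ win K, c n * dU n + ((propSn a β (θ - s) : ℝ) : ℂ) * frameVU a β * σ₂ * ∑ n ∈ win K, c n * dV n‖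
      ≤ ‖((propC a β (θ - s) : ℝ) : ℂ)‖ * ‖σ₂‖ * ‖∑ n ∈ win K, c n * dU n‖ + ‖((propSn a β (θ - s) : ℝ) : ℂ)‖ * ‖frameVU a β‖ * ‖σ₂‖ * ‖∑ n ∈ win K, c n * dV n‖ := by
        refine (norm_add_le _ _).trans (le_of_eq ?_)
        simp only [norm_mul]
    _ ≤ M₀ * (4 * Real.pi * a) * (Real.sqrt E * Real.sqrt 2) + (8 * M₀) * (a * (3 * Real.pi / 2)) * (4 * Real.pi * a) * (Real.sqrt E * (1 / a)) := by
        rw [Complex.norm_real, Complex.norm_real, Real.norm_eq_abs, Real.norm_eq_abs, hσn]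
        gcongr
    _ = a * Real.sqrt E * (M₀ * (4 * Real.pi) * (Real.sqrt 2 + 12 * Real.pi)) := by field_simp; ring

/-- **Pointwise bound, `V` component:** `‖Σ_n c_n V-component of P(θ−s) f_n(s)‖ ≤ √E_in·cosh(8σ⋆)·(4π + 136√2)`. -/
theorem duhamel_sum_V_le {a : ℝ} (ha : 0 < a) (ha1 : a ≤ 1 / 16) {β : ℝ} (hβ : |β| ≤ 1 / 2) {θ s : ℝ} (hs0 : 0 ≤ s) (hsθ : s ≤ θ)
    (hθ : θ ≤ 8) (K : ℕ) (c : ℤ → ℂ) :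
    ‖∑ n ∈ win K, c n * ((propagator a β (θ - s)).mulVec (forcing a β (singleMode (β + n)) s) 0 * Complex.exp (-((Real.pi * β / 2 : ℝ) : ℂ) * Complex.I) -
        (propagator a β (θ - s)).mulVec (forcing a β (singleMode (β + n)) s) 1 * Complex.exp (((Real.pi * β / 2 : ℝ) : ℂ) * Complex.I))‖ ≤
      Real.sqrt (∑ n ∈ win K, ‖c n‖ ^ 2 / (a ^ 2 + (β + n) ^ 2)) * (Real.cosh (8 * sawSigmaStar) * (4 * Real.pi + 136 * Real.sqrt 2)) := by
  set E : ℝ := ∑ n ∈ win K, ‖c n‖ ^ 2 / (a ^ 2 + (β + n) ^ 2) with hE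
  set M₀ : ℝ := Real.cosh (8 * sawSigmaStar) with hM₀
  set σ₂ : ℂ := 2 * ((2 * Real.pi * a : ℝ) * Complex.I : ℂ) with hσ₂
  have hπ := Real.pi_pos
  have hs8 : s ≤ 8 := hsθ.trans hθ
  set dU : ℤ → ℂ := fun n => ∫ y in (-(1 / 2 : ℝ))..(1 / 2),
      ((-lineKernel a β (1 / 4 - y) * Complex.exp (-((Real.pi * β / 2 : ℝ) : ℂ) * Complex.I) +
          lineKernel a β (-(1 / 4) - y) * Complex.exp (((Real.pi * β / 2 : ℝ) : ℂ) * Complex.I)) *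
        Complex.exp (-((2 * Real.pi * a * s * triWave y : ℝ) : ℂ) * Complex.I)) * Complex.exp ((2 * Real.pi * (β + n) * y : ℝ) * Complex.I) with hdU
  set dV : ℤ → ℂ := fun n => ∫ y in (-(1 / 2 : ℝ))..(1 / 2),
      ((-lineKernel a β (1 / 4 - y) * Complex.exp (-((Real.pi * β / 2 : ℝ) : ℂ) * Complex.I) -
          lineKernel a β (-(1 / 4) - y) * Complex.exp (((Real.pi * β / 2 : ℝ) : ℂ) * Complex.I)) *
        Complex.exp (-((2 * Real.pi * a * s * triWave y : ℝ) : ℂ) * Complex.I)) * Complex.exp ((2 * Real.pi * (β + n) * y : ℝ) * Complex.I) with hdV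
  have hterm : ∀ n : ℤ, c n * ((propagator a β (θ - s)).mulVec (forcing a β (singleMode (β + n)) s) 0 * Complex.exp (-((Real.pi * β / 2 : ℝ) : ℂ) * Complex.I) -
        (propagator a β (θ - s)).mulVec (forcing a β (singleMode (β + n)) s) 1 * Complex.exp (((Real.pi * β / 2 : ℝ) : ℂ) * Complex.I)) =
      ((propC a β (θ - s) : ℝ) : ℂ) * σ₂ * (c n * dV n) + ((propSn a β (θ - s) : ℝ) : ℂ) * frameUV a β * σ₂ * (c n * dU n) := by
    intro n
    rw [duhamel_frame_V ha, forcing_frame_U ha, forcing_frame_V ha]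
    ring
  rw [Finset.sum_congr rfl fun n _ => hterm n, Finset.sum_add_distrib, ← Finset.mul_sum, ← Finset.mul_sum]
  have hSU := corner_sum_U_le ha ha1 hβ hs0 hs8 (K := kernelK a β) (G := lineKernel a β) (K' := kernelK' a β) (G' := lineKernel' a β)
    rfl (lineKernel_eq ha β) rfl (fun u => rfl) (win K)
  have hSV := corner_sum_V_le ha ha1 hβ hs0 hs8 (K := kernelK a β) (G := lineKernel a β) (K' := kernelK' a β) (G' := lineKernel' a β)
    rfl (lineKernel_eq ha β) rfl (fun u => rfl) (win K)
  have hCS_U := norm_sum_mul_le_sqrt_mul_sqrt ha.ne' β c dU (win K)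
  have hCS_V := norm_sum_mul_le_sqrt_mul_sqrt ha.ne' β c dV (win K)
  have hU : ‖∑ n ∈ win K, c n * dU n‖ ≤ Real.sqrt E * Real.sqrt 2 :=
    hCS_U.trans (mul_le_mul_of_nonneg_left (Real.sqrt_le_sqrt hSU) (Real.sqrt_nonneg _))
  have hV : ‖∑ n ∈ win K, c n * dV n‖ ≤ Real.sqrt E * (1 / a) := by
    refine hCS_V.trans (mul_le_mul_of_nonneg_left ((Real.sqrt_le_sqrt hSV).trans (le_of_eq ?_)) (Real.sqrt_nonneg _))
    rw [Real.sqrt_div' _ (sq_nonneg a), Real.sqrt_one, Real.sqrt_sq ha.le]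
  obtain ⟨hC, hS⟩ := roof ha β (show 0 ≤ θ - s by linarith) (show θ - s ≤ θ by linarith) hθ
  have hxuv := four_pi_mul_norm_frameUV_le ha ha1 β
  have hσn : ‖σ₂‖ = 4 * Real.pi * a := norm_two_mul_sigma ha
  have hE0 : 0 ≤ Real.sqrt E := Real.sqrt_nonneg _
  have hM1 : 1 ≤ M₀ := Real.one_le_cosh _
  calc ‖((propC a β (θ - s) : ℝ) : ℂ) * σ₂ * ∑ n ∈ win K, c n * dV n + ((propSn a β (θ - s) : ℝ) : ℂ) * frameUV a β * σ₂ * ∑ n ∈ win K, c n * dU n‖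
      ≤ ‖((propC a β (θ - s) : ℝ) : ℂ)‖ * ‖σ₂‖ * ‖∑ n ∈ win K, c n * dV n‖ + ‖((propSn a β (θ - s) : ℝ) : ℂ)‖ * (‖σ₂‖ * ‖frameUV a β‖) * ‖∑ n ∈ win K, c n * dU n‖ := by
        refine (norm_add_le _ _).trans (le_of_eq ?_)
        simp only [norm_mul]; ring
    _ ≤ M₀ * (4 * Real.pi * a) * (Real.sqrt E * (1 / a)) + (8 * M₀) * 17 * (Real.sqrt E * Real.sqrt 2) := by
        rw [Complex.norm_real, Complex.norm_real, Real.norm_eq_abs, Real.norm_eq_abs, hσn]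
        have h17 : 4 * Real.pi * a * ‖frameUV a β‖ ≤ 17 := hxuv
        gcongr
    _ = Real.sqrt E * (M₀ * (4 * Real.pi + 136 * Real.sqrt 2)) := by field_simp; ring

/-! ## §7 (p2 g13) The created pair of a profile in the frame: `Q_U`, `Q_V` as single Duhamel integrals, and their bounds -/

/-- Component `i` of the created amplitudes of a single mode as the integral of the component (any line `a > 0`). -/
theorem sheetAmps_singleMode_apply {a : ℝ} (ha : 0 < a) (β ξ θ : ℝ) (i : Fin 2) :
    sheetAmps a β θ (singleMode ξ) i = ∫ s in (0 : ℝ)..θ, ((propagator a β (θ - s)).mulVec (forcing a β (singleMode ξ) s)) i := by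
  have hint := (continuous_duhamelIntegrand_singleMode_pos ha β ξ θ).intervalIntegrable (μ := volume) 0 θ
  have hcomp := ((ContinuousLinearMap.proj (R := ℂ) (φ := fun _ : Fin 2 => ℂ) i).intervalIntegral_comp_comm hint).symm
  simp only [ContinuousLinearMap.proj_apply] at hcomp
  unfold sheetAmps
  exact hcomp

/-- The component functions of the Duhamel integrand of a single mode are continuous in the slot time. -/
theorem continuous_duhamel_component {a : ℝ} (ha : 0 < a) (β ξ θ : ℝ) (i : Fin 2) :
    Continuous fun s : ℝ => ((propagator a β (θ - s)).mulVec (forcing a β (singleMode ξ) s)) i :=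
  (continuous_apply i).comp (continuous_duhamelIntegrand_singleMode_pos ha β ξ θ)

/-- **`Q_U` of a profile as ONE Duhamel integral of the frame sum.** -/
theorem QU_eq_integral {a : ℝ} (ha : 0 < a) (β θ : ℝ) (K : ℕ) (c : ℤ → ℂ) :
    sheetAmps a β θ ⟨modeProfile β K c, []⟩ 0 * Complex.exp (-((Real.pi * β / 2 : ℝ) : ℂ) * Complex.I) +
        sheetAmps a β θ ⟨modeProfile β K c, []⟩ 1 * Complex.exp (((Real.pi * β / 2 : ℝ) : ℂ) * Complex.I) =
      ∫ s in (0 : ℝ)..θ, ∑ n ∈ win K, c n *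
        ((propagator a β (θ - s)).mulVec (forcing a β (singleMode (β + n)) s) 0 * Complex.exp (-((Real.pi * β / 2 : ℝ) : ℂ) * Complex.I) +
          (propagator a β (θ - s)).mulVec (forcing a β (singleMode (β + n)) s) 1 * Complex.exp (((Real.pi * β / 2 : ℝ) : ℂ) * Complex.I)) := by
  have hc : ∀ n : ℤ, ∀ i : Fin 2, IntervalIntegrable (fun s : ℝ => ((propagator a β (θ - s)).mulVec (forcing a β (singleMode (β + n)) s)) i) volume 0 θ :=
    fun n i => (continuous_duhamel_component ha β (β + n) θ i).intervalIntegrable _ _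
  rw [intervalIntegral.integral_finsetSum (fun n _ => (((hc n 0).mul_const _).add ((hc n 1).mul_const _)).const_mul _)]
  rw [sheetAmps_modeProfile_pos ha β θ K c, Finset.sum_apply, Finset.sum_apply, Finset.sum_mul, Finset.sum_mul, ← Finset.sum_add_distrib]
  refine Finset.sum_congr rfl fun n _ => ?_
  rw [Pi.smul_apply, Pi.smul_apply, smul_eq_mul, smul_eq_mul, sheetAmps_singleMode_apply ha, sheetAmps_singleMode_apply ha,
    intervalIntegral.integral_const_mul, intervalIntegral.integral_add ((hc n 0).mul_const _) ((hc n 1).mul_const _),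
    intervalIntegral.integral_mul_const, intervalIntegral.integral_mul_const]
  ring

/-- **`Q_V` of a profile as ONE Duhamel integral of the frame sum.** -/
theorem QV_eq_integral {a : ℝ} (ha : 0 < a) (β θ : ℝ) (K : ℕ) (c : ℤ → ℂ) :
    sheetAmps a β θ ⟨modeProfile β K c, []⟩ 0 * Complex.exp (-((Real.pi * β / 2 : ℝ) : ℂ) * Complex.I) -
        sheetAmps a β θ ⟨modeProfile β K c, []⟩ 1 * Complex.exp (((Real.pi * β / 2 : ℝ) : ℂ) * Complex.I) =
      ∫ s in (0 : ℝ)..θ, ∑ n ∈ win K, c n *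
        ((propagator a β (θ - s)).mulVec (forcing a β (singleMode (β + n)) s) 0 * Complex.exp (-((Real.pi * β / 2 : ℝ) : ℂ) * Complex.I) -
          (propagator a β (θ - s)).mulVec (forcing a β (singleMode (β + n)) s) 1 * Complex.exp (((Real.pi * β / 2 : ℝ) : ℂ) * Complex.I)) := by
  have hc : ∀ n : ℤ, ∀ i : Fin 2, IntervalIntegrable (fun s : ℝ => ((propagator a β (θ - s)).mulVec (forcing a β (singleMode (β + n)) s)) i) volume 0 θ :=
    fun n i => (continuous_duhamel_component ha β (β + n) θ i).intervalIntegrable _ _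
  rw [intervalIntegral.integral_finsetSum (fun n _ => (((hc n 0).mul_const _).sub ((hc n 1).mul_const _)).const_mul _)]
  rw [sheetAmps_modeProfile_pos ha β θ K c, Finset.sum_apply, Finset.sum_apply, Finset.sum_mul, Finset.sum_mul, ← Finset.sum_sub_distrib]
  refine Finset.sum_congr rfl fun n _ => ?_
  rw [Pi.smul_apply, Pi.smul_apply, smul_eq_mul, smul_eq_mul, sheetAmps_singleMode_apply ha, sheetAmps_singleMode_apply ha,
    intervalIntegral.integral_const_mul, intervalIntegral.integral_sub ((hc n 0).mul_const _) ((hc n 1).mul_const _),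
    intervalIntegral.integral_mul_const, intervalIntegral.integral_mul_const]
  ring

/-- **`|Q_U| ≤ 8a·√E_in·L_U`.** -/
theorem norm_QU_le {a : ℝ} (ha : 0 < a) (ha1 : a ≤ 1 / 16) {β : ℝ} (hβ : |β| ≤ 1 / 2) {θ : ℝ} (hθ0 : 0 ≤ θ) (hθ : θ ≤ 8) (K : ℕ) (c : ℤ → ℂ) :
    ‖sheetAmps a β θ ⟨modeProfile β K c, []⟩ 0 * Complex.exp (-((Real.pi * β / 2 : ℝ) : ℂ) * Complex.I) +
        sheetAmps a β θ ⟨modeProfile β K c, []⟩ 1 * Complex.exp (((Real.pi * β / 2 : ℝ) : ℂ) * Complex.I)‖ ≤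
      8 * (a * Real.sqrt (∑ n ∈ win K, ‖c n‖ ^ 2 / (a ^ 2 + (β + n) ^ 2)) * (Real.cosh (8 * sawSigmaStar) * (4 * Real.pi) * (Real.sqrt 2 + 12 * Real.pi))) := by
  rw [QU_eq_integral ha]
  have h := intervalIntegral.norm_integral_le_of_norm_le_const (a := (0 : ℝ)) (b := θ)
    (C := a * Real.sqrt (∑ n ∈ win K, ‖c n‖ ^ 2 / (a ^ 2 + (β + n) ^ 2)) * (Real.cosh (8 * sawSigmaStar) * (4 * Real.pi) * (Real.sqrt 2 + 12 * Real.pi)))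
    (f := fun s => ∑ n ∈ win K, c n *
        ((propagator a β (θ - s)).mulVec (forcing a β (singleMode (β + n)) s) 0 * Complex.exp (-((Real.pi * β / 2 : ℝ) : ℂ) * Complex.I) +
          (propagator a β (θ - s)).mulVec (forcing a β (singleMode (β + n)) s) 1 * Complex.exp (((Real.pi * β / 2 : ℝ) : ℂ) * Complex.I)))
    (fun s hs => by
      rw [uIoc_of_le hθ0] at hs
      exact duhamel_sum_U_le ha ha1 hβ hs.1.le hs.2 hθ K c)
  refine h.trans ?_
  rw [sub_zero, abs_of_nonneg hθ0]
  have h0 : 0 ≤ a * Real.sqrt (∑ n ∈ win K, ‖c n‖ ^ 2 / (a ^ 2 + (β + n) ^ 2)) * (Real.cosh (8 * sawSigmaStar) * (4 * Real.pi) * (Real.sqrt 2 + 12 * Real.pi)) := by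
    have := Real.pi_pos; have := Real.cosh_pos (8 * sawSigmaStar); positivity
  nlinarith

/-- **`|Q_V| ≤ 8·√E_in·L_V`.** -/
theorem norm_QV_le {a : ℝ} (ha : 0 < a) (ha1 : a ≤ 1 / 16) {β : ℝ} (hβ : |β| ≤ 1 / 2) {θ : ℝ} (hθ0 : 0 ≤ θ) (hθ : θ ≤ 8) (K : ℕ) (c : ℤ → ℂ) :
    ‖sheetAmps a β θ ⟨modeProfile β K c, []⟩ 0 * Complex.exp (-((Real.pi * β / 2 : ℝ) : ℂ) * Complex.I) -
        sheetAmps a β θ ⟨modeProfile β K c, []⟩ 1 * Complex.exp (((Real.pi * β / 2 : ℝ) : ℂ) * Complex.I)‖ ≤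
      8 * (Real.sqrt (∑ n ∈ win K, ‖c n‖ ^ 2 / (a ^ 2 + (β + n) ^ 2)) * (Real.cosh (8 * sawSigmaStar) * (4 * Real.pi + 136 * Real.sqrt 2))) := by
  rw [QV_eq_integral ha]
  have h := intervalIntegral.norm_integral_le_of_norm_le_const (a := (0 : ℝ)) (b := θ)
    (C := Real.sqrt (∑ n ∈ win K, ‖c n‖ ^ 2 / (a ^ 2 + (β + n) ^ 2)) * (Real.cosh (8 * sawSigmaStar) * (4 * Real.pi + 136 * Real.sqrt 2)))
    (f := fun s => ∑ n ∈ win K, c n *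
        ((propagator a β (θ - s)).mulVec (forcing a β (singleMode (β + n)) s) 0 * Complex.exp (-((Real.pi * β / 2 : ℝ) : ℂ) * Complex.I) -
          (propagator a β (θ - s)).mulVec (forcing a β (singleMode (β + n)) s) 1 * Complex.exp (((Real.pi * β / 2 : ℝ) : ℂ) * Complex.I)))
    (fun s hs => by
      rw [uIoc_of_le hθ0] at hs
      exact duhamel_sum_V_le ha ha1 hβ hs.1.le hs.2 hθ K c)
  refine h.trans ?_
  rw [sub_zero, abs_of_nonneg hθ0]
  have h0 : 0 ≤ Real.sqrt (∑ n ∈ win K, ‖c n‖ ^ 2 / (a ^ 2 + (β + n) ^ 2)) * (Real.cosh (8 * sawSigmaStar) * (4 * Real.pi + 136 * Real.sqrt 2)) := by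
    have := Real.pi_pos; have := Real.cosh_pos (8 * sawSigmaStar); positivity
  nlinarith

/-! ## §8 (p2 g13) Column parity of the straight pair: `|Z_n| = |Q_U|` on even columns, `|Q_V|` on odd columns -/

/-- Every column of the created pair is bounded by the two frame components: `|Z_n|² ≤ |Q_U|² + |Q_V|²`
(`|Z_n| = |Q_U|` for even `n`, `|Q_V|` for odd `n`). -/
theorem norm_sq_column_le (b : ℝ) (q : Fin 2 → ℂ) (n : ℤ) :
    ‖q 0 * Complex.exp (-(Real.pi * (b + n) / 2 : ℝ) * Complex.I) + q 1 * Complex.exp ((Real.pi * (b + n) / 2 : ℝ) * Complex.I)‖ ^ 2 ≤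
      ‖q 0 * Complex.exp (-((Real.pi * b / 2 : ℝ) : ℂ) * Complex.I) + q 1 * Complex.exp (((Real.pi * b / 2 : ℝ) : ℂ) * Complex.I)‖ ^ 2 +
        ‖q 0 * Complex.exp (-((Real.pi * b / 2 : ℝ) : ℂ) * Complex.I) - q 1 * Complex.exp (((Real.pi * b / 2 : ℝ) : ℂ) * Complex.I)‖ ^ 2 := by
  set ep : ℂ := Complex.exp (((Real.pi * b / 2 : ℝ) : ℂ) * Complex.I) with hep
  set em : ℂ := Complex.exp (-((Real.pi * b / 2 : ℝ) : ℂ) * Complex.I) with hem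
  rcases Int.even_or_odd n with ⟨r, hr⟩ | ⟨r, hr⟩
  · -- even column: `Z_n = e^{−iπr}·Q_U`
    have e1 : Complex.exp (((Real.pi * (b + n) / 2 : ℝ) : ℂ) * Complex.I) = ep * Complex.exp (-((Real.pi * r : ℝ) : ℂ) * Complex.I) := by
      rw [hep, ← Complex.exp_add, show ((Real.pi * (b + n) / 2 : ℝ) : ℂ) * Complex.I =
        (((Real.pi * b / 2 : ℝ) : ℂ) * Complex.I + -((Real.pi * r : ℝ) : ℂ) * Complex.I) + (r : ℂ) * (2 * Real.pi * Complex.I) by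
          rw [hr]; push_cast; ring, Complex.exp_add, Complex.exp_int_mul_two_pi_mul_I, mul_one]
    have e2 : Complex.exp (-((Real.pi * (b + n) / 2 : ℝ) : ℂ) * Complex.I) = em * Complex.exp (-((Real.pi * r : ℝ) : ℂ) * Complex.I) := by
      rw [hem, ← Complex.exp_add]; congr 1; rw [hr]; push_cast; ring
    have hZ : q 0 * Complex.exp (-(Real.pi * (b + n) / 2 : ℝ) * Complex.I) + q 1 * Complex.exp ((Real.pi * (b + n) / 2 : ℝ) * Complex.I) =
        Complex.exp (-((Real.pi * r : ℝ) : ℂ) * Complex.I) * (q 0 * em + q 1 * ep) := by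
      rw [e1, e2]; ring
    have hn1 : ‖Complex.exp (-((Real.pi * r : ℝ) : ℂ) * Complex.I)‖ = 1 := by
      rw [show -((Real.pi * r : ℝ) : ℂ) * Complex.I = ((-(Real.pi * r) : ℝ) : ℂ) * Complex.I by push_cast; ring]; exact Complex.norm_exp_ofReal_mul_I _
    rw [hZ, norm_mul, hn1, one_mul]
    nlinarith [norm_nonneg (q 0 * em - q 1 * ep)]
  · -- odd column: `Z_n = e^{−iπr}e^{−iπ/2}·Q_V`
    have e1 : Complex.exp (((Real.pi * (b + n) / 2 : ℝ) : ℂ) * Complex.I) =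
        -(ep * Complex.exp (-((Real.pi * r : ℝ) : ℂ) * Complex.I) * Complex.exp (-((Real.pi / 2 : ℝ) : ℂ) * Complex.I)) := by
      rw [hep, ← Complex.exp_add, ← Complex.exp_add, show ((Real.pi * (b + n) / 2 : ℝ) : ℂ) * Complex.I =
        ((((Real.pi * b / 2 : ℝ) : ℂ) * Complex.I + -((Real.pi * r : ℝ) : ℂ) * Complex.I + -((Real.pi / 2 : ℝ) : ℂ) * Complex.I) +
          (r : ℂ) * (2 * Real.pi * Complex.I)) + Real.pi * Complex.I by rw [hr]; push_cast; ring,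
        Complex.exp_add, Complex.exp_add, Complex.exp_int_mul_two_pi_mul_I, mul_one, Complex.exp_pi_mul_I]
      ring
    have e2 : Complex.exp (-((Real.pi * (b + n) / 2 : ℝ) : ℂ) * Complex.I) =
        em * Complex.exp (-((Real.pi * r : ℝ) : ℂ) * Complex.I) * Complex.exp (-((Real.pi / 2 : ℝ) : ℂ) * Complex.I) := by
      rw [hem, ← Complex.exp_add, ← Complex.exp_add]; congr 1; rw [hr]; push_cast; ring
    have hZ : q 0 * Complex.exp (-(Real.pi * (b + n) / 2 : ℝ) * Complex.I) + q 1 * Complex.exp ((Real.pi * (b + n) / 2 : ℝ) * Complex.I) =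
        (Complex.exp (-((Real.pi * r : ℝ) : ℂ) * Complex.I) * Complex.exp (-((Real.pi / 2 : ℝ) : ℂ) * Complex.I)) * (q 0 * em - q 1 * ep) := by
      rw [e1, e2]; ring
    have hn1 : ‖Complex.exp (-((Real.pi * r : ℝ) : ℂ) * Complex.I) * Complex.exp (-((Real.pi / 2 : ℝ) : ℂ) * Complex.I)‖ = 1 := by
      rw [norm_mul, show -((Real.pi * r : ℝ) : ℂ) * Complex.I = ((-(Real.pi * r) : ℝ) : ℂ) * Complex.I by push_cast; ring,
        show -((Real.pi / 2 : ℝ) : ℂ) * Complex.I = ((-(Real.pi / 2) : ℝ) : ℂ) * Complex.I by push_cast; ring,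
        Complex.norm_exp_ofReal_mul_I, Complex.norm_exp_ofReal_mul_I, mul_one]
    rw [hZ, norm_mul, hn1, one_mul]
    nlinarith [norm_nonneg (q 0 * em + q 1 * ep)]

/-- The off-corner columns have bounded total weight: `Σ_{|n| ≤ K, n ≠ 0} 1/(a² + (b+n)²) ≤ 4π²/3` for `|b| ≤ ½`. -/
theorem sum_weights_off_zero_le {a : ℝ} (ha : 0 < a) {b : ℝ} (hb : |b| ≤ 1 / 2) (K : ℕ) :
    ∑ n ∈ (win K).erase 0, 1 / (a ^ 2 + (b + n) ^ 2) ≤ 4 * Real.pi ^ 2 / 3 := by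
  have hπ := Real.pi_pos
  have hle : ∀ n ∈ (win K).erase 0, 1 / (a ^ 2 + (b + n) ^ 2) ≤ 2 * Real.pi ^ 2 * (2 / (Real.pi ^ 2 * (n : ℝ) ^ 2)) := by
    intro n hn
    have hn0 : n ≠ 0 := (Finset.mem_erase.1 hn).1
    have h := lineWeight_le_inv_pi_sq_mul_sq ha hb hn0
    have hm0 : (0 : ℝ) < (n : ℝ) ^ 2 := by
      have : (n : ℝ) ≠ 0 := by exact_mod_cast hn0
      exact lt_of_le_of_ne (sq_nonneg _) (Ne.symm (pow_ne_zero 2 this))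
    rw [div_le_div_iff₀ (by positivity) (by positivity)] at h
    have h2 : Real.pi ^ 2 * (n : ℝ) ^ 2 ≤ Real.pi ^ 2 * (4 * (a ^ 2 + (b + n) ^ 2)) := by linarith
    have h3 := le_of_mul_le_mul_left h2 (by positivity : (0 : ℝ) < Real.pi ^ 2)
    rw [show 2 * Real.pi ^ 2 * (2 / (Real.pi ^ 2 * (n : ℝ) ^ 2)) = 4 / (n : ℝ) ^ 2 by field_simp; ring,
      div_le_div_iff₀ (by positivity) hm0]
    linarith
  have hsum := sum_le_hasSum ((win K).erase 0) (fun n _ => by positivity) hasSum_two_div_pi_sq_mul_sq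
  calc ∑ n ∈ (win K).erase 0, 1 / (a ^ 2 + (b + n) ^ 2) ≤ ∑ n ∈ (win K).erase 0, 2 * Real.pi ^ 2 * (2 / (Real.pi ^ 2 * (n : ℝ) ^ 2)) :=
        Finset.sum_le_sum hle
    _ = 2 * Real.pi ^ 2 * ∑ n ∈ (win K).erase 0, 2 / (Real.pi ^ 2 * (n : ℝ) ^ 2) := by rw [Finset.mul_sum]
    _ ≤ 2 * Real.pi ^ 2 * (2 / 3) := mul_le_mul_of_nonneg_left hsum (by positivity)
    _ = 4 * Real.pi ^ 2 / 3 := by ring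

/-- **The line energy through the frame:** for `|b| ≤ ½`,
`lineEnergyOut a b K q ≤ |Q_U|²·(1/(a²+b²) + 4π²/3) + |Q_V|²·4π²/3` — the corner column `n = 0` sees only `Q_U`. -/
theorem lineEnergyOut_le_frame {a : ℝ} (ha : 0 < a) {b : ℝ} (hb : |b| ≤ 1 / 2) (K : ℕ) (q : Fin 2 → ℂ) :
    lineEnergyOut a b K q ≤
      ‖q 0 * Complex.exp (-((Real.pi * b / 2 : ℝ) : ℂ) * Complex.I) + q 1 * Complex.exp (((Real.pi * b / 2 : ℝ) : ℂ) * Complex.I)‖ ^ 2 *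
          (1 / (a ^ 2 + b ^ 2) + 4 * Real.pi ^ 2 / 3) +
        ‖q 0 * Complex.exp (-((Real.pi * b / 2 : ℝ) : ℂ) * Complex.I) - q 1 * Complex.exp (((Real.pi * b / 2 : ℝ) : ℂ) * Complex.I)‖ ^ 2 *
          (4 * Real.pi ^ 2 / 3) := by
  set QU : ℝ := ‖q 0 * Complex.exp (-((Real.pi * b / 2 : ℝ) : ℂ) * Complex.I) + q 1 * Complex.exp (((Real.pi * b / 2 : ℝ) : ℂ) * Complex.I)‖ with hQU
  set QV : ℝ := ‖q 0 * Complex.exp (-((Real.pi * b / 2 : ℝ) : ℂ) * Complex.I) - q 1 * Complex.exp (((Real.pi * b / 2 : ℝ) : ℂ) * Complex.I)‖ with hQV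
  have h0 : (0 : ℤ) ∈ win K := by simp [win]
  unfold lineEnergyOut
  rw [← Finset.add_sum_erase _ _ h0]
  have hz : ‖q 0 * Complex.exp (-(Real.pi * (b + ((0 : ℤ) : ℝ)) / 2 : ℝ) * Complex.I) + q 1 * Complex.exp ((Real.pi * (b + ((0 : ℤ) : ℝ)) / 2 : ℝ) * Complex.I)‖ ^ 2 /
      (a ^ 2 + (b + ((0 : ℤ) : ℝ)) ^ 2) = QU ^ 2 * (1 / (a ^ 2 + b ^ 2)) := by
    rw [hQU]; simp only [Int.cast_zero, add_zero, mul_one_div]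
  have hrest : ∑ n ∈ (win K).erase 0, ‖q 0 * Complex.exp (-(Real.pi * (b + n) / 2 : ℝ) * Complex.I) + q 1 * Complex.exp ((Real.pi * (b + n) / 2 : ℝ) * Complex.I)‖ ^ 2 /
      (a ^ 2 + (b + n) ^ 2) ≤ (QU ^ 2 + QV ^ 2) * (4 * Real.pi ^ 2 / 3) := by
    calc ∑ n ∈ (win K).erase 0, ‖q 0 * Complex.exp (-(Real.pi * (b + n) / 2 : ℝ) * Complex.I) + q 1 * Complex.exp ((Real.pi * (b + n) / 2 : ℝ) * Complex.I)‖ ^ 2 /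
          (a ^ 2 + (b + n) ^ 2)
        ≤ ∑ n ∈ (win K).erase 0, (QU ^ 2 + QV ^ 2) * (1 / (a ^ 2 + (b + n) ^ 2)) := by
          refine Finset.sum_le_sum fun n _ => ?_
          rw [← mul_one_div]
          exact mul_le_mul_of_nonneg_right (norm_sq_column_le b q n) (by positivity)
      _ = (QU ^ 2 + QV ^ 2) * ∑ n ∈ (win K).erase 0, 1 / (a ^ 2 + (b + n) ^ 2) := by rw [Finset.mul_sum]
      _ ≤ (QU ^ 2 + QV ^ 2) * (4 * Real.pi ^ 2 / 3) := mul_le_mul_of_nonneg_left (sum_weights_off_zero_le ha hb K) (by positivity)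
  rw [hz]
  nlinarith [hrest, sq_nonneg QU, sq_nonneg QV, Real.pi_pos]

/-! ## §9 (p2 g13) THE CORNER LAW -/

/-- The constant of the corner law (truth-only; astronomically lossy). -/
def cornerConst : ℝ :=
  64 * Real.cosh (8 * sawSigmaStar) ^ 2 *
    (((4 * Real.pi) * (Real.sqrt 2 + 12 * Real.pi)) ^ 2 * (1 + 4 * Real.pi ^ 2 / 3) + (4 * Real.pi + 136 * Real.sqrt 2) ^ 2 * (4 * Real.pi ^ 2 / 3))

theorem cornerConst_nonneg : 0 ≤ cornerConst := by unfold cornerConst; positivity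

/-- **The law on the lines `0 < a ≤ 1/16`, Bloch offsets `|β| ≤ ½`.** -/
theorem coreLaw_pos {a : ℝ} (ha : 0 < a) (ha1 : a ≤ 1 / 16) {β : ℝ} (hβ : |β| ≤ 1 / 2) {θ : ℝ} (hθ0 : 0 ≤ θ) (hθ : θ ≤ 8) (K : ℕ) (c : ℤ → ℂ) :
    lineEnergyOut a β K (sheetAmps a β θ ⟨modeProfile β K c, []⟩) ≤ cornerConst * ∑ n ∈ win K, ‖c n‖ ^ 2 / (a ^ 2 + (β + n) ^ 2) := by
  set E : ℝ := ∑ n ∈ win K, ‖c n‖ ^ 2 / (a ^ 2 + (β + n) ^ 2) with hE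
  set q := sheetAmps a β θ ⟨modeProfile β K c, []⟩ with hq
  set M₀ : ℝ := Real.cosh (8 * sawSigmaStar) with hM₀
  set L₁ : ℝ := (4 * Real.pi) * (Real.sqrt 2 + 12 * Real.pi) with hL₁
  set L₂ : ℝ := 4 * Real.pi + 136 * Real.sqrt 2 with hL₂
  set QU : ℝ := ‖q 0 * Complex.exp (-((Real.pi * β / 2 : ℝ) : ℂ) * Complex.I) + q 1 * Complex.exp (((Real.pi * β / 2 : ℝ) : ℂ) * Complex.I)‖ with hQU
  set QV : ℝ := ‖q 0 * Complex.exp (-((Real.pi * β / 2 : ℝ) : ℂ) * Complex.I) - q 1 * Complex.exp (((Real.pi * β / 2 : ℝ) : ℂ) * Complex.I)‖ with hQV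
  have hπ := Real.pi_pos
  have hE0 : 0 ≤ E := Finset.sum_nonneg fun n _ => by positivity
  have hsq : Real.sqrt E ^ 2 = E := Real.sq_sqrt hE0
  have hU : QU ≤ 8 * (a * Real.sqrt E * (M₀ * (4 * Real.pi) * (Real.sqrt 2 + 12 * Real.pi))) := norm_QU_le ha ha1 hβ hθ0 hθ K c
  have hV : QV ≤ 8 * (Real.sqrt E * (M₀ * (4 * Real.pi + 136 * Real.sqrt 2))) := norm_QV_le ha ha1 hβ hθ0 hθ K c
  have hU' : QU ≤ 8 * a * Real.sqrt E * M₀ * L₁ := by rw [hL₁]; linarith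
  have hV' : QV ≤ 8 * Real.sqrt E * M₀ * L₂ := by rw [hL₂]; linarith
  have hQU0 : 0 ≤ QU := norm_nonneg _
  have hQV0 : 0 ≤ QV := norm_nonneg _
  have hUsq : QU ^ 2 ≤ 64 * a ^ 2 * E * (M₀ * L₁) ^ 2 := by
    have h := pow_le_pow_left₀ hQU0 hU' 2
    rw [show (8 * a * Real.sqrt E * M₀ * L₁) ^ 2 = 64 * a ^ 2 * Real.sqrt E ^ 2 * (M₀ * L₁) ^ 2 by ring, hsq] at h
    exact h
  have hVsq : QV ^ 2 ≤ 64 * E * (M₀ * L₂) ^ 2 := by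
    have h := pow_le_pow_left₀ hQV0 hV' 2
    rw [show (8 * Real.sqrt E * M₀ * L₂) ^ 2 = 64 * Real.sqrt E ^ 2 * (M₀ * L₂) ^ 2 by ring, hsq] at h
    exact h
  have hframe := lineEnergyOut_le_frame ha hβ K q
  have hab : 0 < a ^ 2 + β ^ 2 := by positivity
  have h1 : QU ^ 2 * (1 / (a ^ 2 + β ^ 2)) ≤ 64 * E * (M₀ * L₁) ^ 2 := by
    rw [mul_one_div, div_le_iff₀ hab]
    nlinarith [mul_nonneg (mul_nonneg hE0 (sq_nonneg (M₀ * L₁))) (sq_nonneg β)]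
  have ha2 : a ^ 2 ≤ 1 := by nlinarith
  have h2 : QU ^ 2 ≤ 64 * E * (M₀ * L₁) ^ 2 := by nlinarith [mul_nonneg hE0 (sq_nonneg (M₀ * L₁))]
  have hC : cornerConst = 64 * M₀ ^ 2 * (L₁ ^ 2 * (1 + 4 * Real.pi ^ 2 / 3) + L₂ ^ 2 * (4 * Real.pi ^ 2 / 3)) := by
    rw [hM₀, hL₁, hL₂]; rfl
  rw [hC]
  have hp : 0 ≤ 4 * Real.pi ^ 2 / 3 := by positivity
  calc lineEnergyOut a β K q ≤ QU ^ 2 * (1 / (a ^ 2 + β ^ 2) + 4 * Real.pi ^ 2 / 3) + QV ^ 2 * (4 * Real.pi ^ 2 / 3) := hframe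
    _ = QU ^ 2 * (1 / (a ^ 2 + β ^ 2)) + QU ^ 2 * (4 * Real.pi ^ 2 / 3) + QV ^ 2 * (4 * Real.pi ^ 2 / 3) := by ring
    _ ≤ 64 * E * (M₀ * L₁) ^ 2 + 64 * E * (M₀ * L₁) ^ 2 * (4 * Real.pi ^ 2 / 3) + 64 * E * (M₀ * L₂) ^ 2 * (4 * Real.pi ^ 2 / 3) := by
        gcongr
    _ = 64 * M₀ ^ 2 * (L₁ ^ 2 * (1 + 4 * Real.pi ^ 2 / 3) + L₂ ^ 2 * (4 * Real.pi ^ 2 / 3)) * E := by ring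

/-- **The law on the lines `0 < |a| ≤ 1/16`, Bloch offsets `|β| ≤ ½`** (negative lines by conjugation). -/
theorem coreLaw_ne {a : ℝ} (ha : a ≠ 0) (ha1 : |a| ≤ 1 / 16) {β : ℝ} (hβ : |β| ≤ 1 / 2) {θ : ℝ} (hθ0 : 0 ≤ θ) (hθ : θ ≤ 8) (K : ℕ) (c : ℤ → ℂ) :
    lineEnergyOut a β K (sheetAmps a β θ ⟨modeProfile β K c, []⟩) ≤ cornerConst * ∑ n ∈ win K, ‖c n‖ ^ 2 / (a ^ 2 + (β + n) ^ 2) := by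
  rcases lt_or_gt_of_ne ha with hneg | hpos
  · have ha' : 0 < -a := by linarith
    have ha1' : -a ≤ 1 / 16 := by rw [abs_of_neg hneg] at ha1; exact ha1
    have hβ' : |(-β)| ≤ 1 / 2 := by rwa [abs_neg]
    exact lineLaw_of_conj hneg (coreLaw_pos ha' ha1' hβ' hθ0 hθ K (fun n => starRingEnd ℂ (c (-n))))
  · rw [abs_of_pos hpos] at ha1
    exact coreLaw_pos hpos ha1 hβ hθ0 hθ K c

/-- **THE CORNER LAW (B1 of record, arbiter A28-10″/A28-11):** `CoreStripLaw (1/16) cornerConst` — on every line `|a| < 1/16`, for every Bloch offset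
`b ∈ [0,1]`, strain `θ ∈ [0,8]`, window `K` and profile `c`, the lattice line energy of the created straight pair is at most `cornerConst ×` the line's input
energy, uniformly as `(a, b) → (0, 0)` and `(a, b) → (0, 1)`. -/
theorem coreStripLaw_sixteenth : CoreStripLaw (1 / 16) cornerConst := by
  intro a b θ K c ha hb0 hb1 hθ0 hθ
  have hS0 : 0 ≤ ∑ n ∈ win K, ‖c n‖ ^ 2 / (a ^ 2 + (b + n) ^ 2) := Finset.sum_nonneg fun _ _ => by positivity
  rcases eq_or_ne a 0 with h0 | hne
  · subst h0
    rw [sheetAmps_zero_line, lineEnergyOut_zero]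
    exact mul_nonneg cornerConst_nonneg hS0
  by_cases hb : b ≤ 1 / 2
  · exact coreLaw_ne hne ha.le (abs_le.2 ⟨by linarith, hb⟩) hθ0 hθ K c
  · rw [not_le] at hb
    exact lineLaw_of_shift (coreLaw_ne hne ha.le (abs_le.2 ⟨by linarith, by linarith⟩) hθ0 hθ (K + 1) (shiftCoef K c))

/-- **B1 OF RECORD, existential form:** `∃ a₀ > 0, ∃ C ≥ 0, CoreStripLaw a₀ C`.  With `K2CoreLineLaw.coreLineLaw_of_strip` and
`K2CreationLaws.entryBoundsW_of_coreLineLaw` (same verbatim definitions) this closes the truth half of the K2 chain: `EntryBoundsW θ 0 M D` for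
every cell, class, truncation and age. -/
theorem coreStripLaw_corner : ∃ a₀ > 0, ∃ C ≥ 0, CoreStripLaw a₀ C :=
  ⟨1 / 16, by norm_num, cornerConst, cornerConst_nonneg, coreStripLaw_sixteenth⟩

end

end Summit.AnomalousDissipation.AnomalousDissipation.Cruxes.K1LocalisedCascade.K2CornerLaw
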